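import Literature.Probability.LatticeModels.PlanarIsingDomainSpinor
import Literature.Analysis.Complex.BocherTheorem
import Literature.Analysis.Complex.HarmonicMaxPrinciple
import HarnessLib

/-!
# Uniqueness of CHI's spinor boundary value problem in the half-plane (Prop. 3.9 ⇒ Remark 2.9 (i)), squared form

Topic `Literature/Probability/LatticeModels`. Chelkak–Hongler–Izyurov, Ann. of Math. 181 (2015) =
arXiv:1202.2838v2 ("CHI15"). The identification step of the convergence theorems (Thm 2.16 "obs-away",
whence Thms 2.18, 2.20 and the named facts `chi_freePlusTwoPoint_ratio`, `chi_plusTwoPoint_*` of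
`PlanarIsingOnePointSplit.lean`) reads (§3.4, p. 27): every subsequential limit `f̃` of the
renormalised discrete spinors has a harmonic, single-valued `h̃ = Re ∫ f̃²` with the properties
(1)–(4) of Prop. 3.9, "then the uniqueness proven in Remark 2.9 (i) implies `f̃ = f_{[Ω,a;b]}`".
Prop. 3.9 (for `k = 1`): (1) `h ≡ 0` on `∂Ω`; (2) "there is no point `z₀` on `∂Ω` such that
`h ≥ 0` in a neighborhood of `z₀`"; (3) `h` is bounded from below near `b`; (4) normalisation at the
source `a`; and "if `h` satisfies (1)–(4), then `f` solves the boundary value problem (2.6)–(2.8)",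
whose solution is unique (Remark 2.9 (i)) and is the explicit spinor (2.21) in `ℍ`.

This file PROVES that implication in the half-plane, in the branch-free (squared) language of the
tree (`spinorSqCHI a b = f_{[ℍ,a;b]}²`, `PlanarIsingHalfPlaneSpinor.lean`): a holomorphic `q` on
`ℍ ∖ {a,b}` which is locally a square (a spinor squared), branches at `b` (`(w-b)q` is a square near
`b`), and whose real primitive `h` (`dh = Re(q dw)`) satisfies (1) `h → 0` at `∂ℍ ∪ {∞}`,
(2) in the prime-end form "every boundary half-disc contains a point where `h ≤ 0`", (3) and
(4) `(w-a)q(w) → 1`, equals `f_{[ℍ,a;b]}²` (`eqOn_spinorSqCHI_of_bvp`). The proof is the classical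
potential theory behind CHI's remark: Bôcher's theorem at `b`
(`Literature/Analysis/Complex/BocherTheorem.lean`), a removable singularity at `a`, the maximum
principle for `h + G_ℍ(·;a) - c G_ℍ(·;b)` on `ℍ` (`HarmonicMaxPrinciple.lean`), and the boundary sign
analysis on `ℝ` pinning the residue `c` at `b` to `𝓑_ℍ(a;b)²`: for `c > 𝓑²`, `∂_y h > 0` on an
interval, contradicting (2); for `0 < c < 𝓑²`, `q` has a simple zero in `ℍ`, contradicting the spinor
structure; `c = 0` contradicts the branching at `b`. (On rough domains the planar-neighbourhood
reading of (2) is not sufficient — a slit disc carries spurious solutions `-G_a + cG_b` violating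
positivity on one bank only; the prime-end form used here is the one delivered by the one-sided
contour argument of Chelkak–Smirnov 2012, Remark 6.3, which CHI invoke.) The general simply
connected domain follows by conformal transport (`PlanarIsingDomainSpinorUniqueness.lean`).
§5 treats the companion "renormalised" case of §3.4 (the limits of `(M_δ(ε))⁻¹ H_δ`, whose source
singularity is scaled away): if instead of (4) `h` is bounded near `a`, then (1)–(3) force `h ≡ 0` and
`q ≡ 0` (`eq_zero_of_bvp_bounded`) — CHI's "this yields `h̃ ≡ 0`, which is a contradiction".

Everything is proved; no named fact is introduced. Auxiliary definitions: the one-parameter family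
`greenComboCHI a b c = -G_ℍ(·;a) + c G_ℍ(·;b)` of candidate primitives and its complex gradient
`greenComboSqCHI a b c` (for `c = 𝓑²` these are `spinorPrimCHI`, `spinorSqCHI`).

## References

* D. Chelkak, C. Hongler, K. Izyurov, Ann. of Math. (2) 181 (2015) 1087–1138 = arXiv:1202.2838v2:
  Def. 2.8, Remark 2.9 (i), Prop. 3.9, §3.4 (proof of Thm 2.16). [ChelkakHonglerIzyurovAnnals2015]
* D. Chelkak, S. Smirnov, Invent. Math. 189 (2012), Remark 6.3. [ChelkakSmirnov2012]
* S. Axler, P. Bourdon, W. Ramey, *Harmonic Function Theory* (2001), Thm. 3.9. [AxlerBourdonRamey2001]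
-/

noncomputable section

open Filter Topology Metric Set Real Complex InnerProductSpace
open scoped ComplexConjugate
open Literature.Probability.LatticeModels Literature.Analysis.Complex

namespace Literature.Probability.LatticeModels

/-! ### 0. Real-linear bookkeeping: `h` determines `q`; `Re ∫ q` is harmonic -/

/-- `c ↦ reMul c` is injective: `Re(c·1)` and `Re(c·i)` recover `c`. [folklore] -/
theorem reMul_injective {c d : ℂ} (h : reMul c = reMul d) : c = d := by
  have h1 := congrArg (fun L : ℂ →L[ℝ] ℝ => L 1) h
  have hI := congrArg (fun L : ℂ →L[ℝ] ℝ => L I) h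
  simp only [reMul_apply, mul_one] at h1
  simp only [reMul_apply, Complex.mul_re, Complex.I_re, mul_zero, Complex.I_im, mul_one, zero_sub, neg_inj] at hI
  exact Complex.ext h1 hI

/-- If `dh(z) = Re(c ·) = Re(d ·)` then `c = d`. [folklore] -/
theorem eq_of_hasFDerivAt_reMul {h : ℂ → ℝ} {z c d : ℂ} (hc : HasFDerivAt h (reMul c) z)
    (hd : HasFDerivAt h (reMul d) z) : c = d :=
  reMul_injective (hc.unique hd)

/-- **`h = Re ∫ q` is harmonic**: if `q` is holomorphic on an open set `U` and the real function `h`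
has differential `v ↦ Re(q(z) v)` at every point of `U`, then `h` is harmonic on `U` (locally
`h = Re Q + const` for a primitive `Q` of `q`). [folklore] -/
theorem harmonicAt_of_hasFDerivAt_reMul {U : Set ℂ} (hU : IsOpen U) {q : ℂ → ℂ}
    (hq : DifferentiableOn ℂ q U) {h : ℂ → ℝ} (hh : ∀ z ∈ U, HasFDerivAt h (reMul (q z)) z)
    {z : ℂ} (hz : z ∈ U) : HarmonicAt h z := by
  obtain ⟨r, hr, hball⟩ := Metric.isOpen_iff.1 hU z hz
  obtain ⟨G, hG⟩ := (hq.mono hball).isExactOn_ball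
  set w : ℂ → ℝ := fun x => h x - (G x).re with hw
  have hwderiv : ∀ x ∈ ball z r, HasFDerivAt w (0 : ℂ →L[ℝ] ℝ) x := by
    intro x hx
    have h1 := hh x (hball hx)
    have h2 : HasFDerivAt (fun x => (G x).re)
        (reCLM.comp ((ContinuousLinearMap.smulRight (1 : ℂ →L[ℂ] ℂ) (q x)).restrictScalars ℝ)) x :=
      reCLM.hasFDerivAt.comp x ((hG x hx).hasFDerivAt.restrictScalars ℝ)
    refine (h1.sub h2).congr_fderiv (ContinuousLinearMap.ext fun v => ?_)
    simp [mul_comm]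
  have hwd : DifferentiableOn ℝ w (ball z r) := fun x hx => (hwderiv x hx).differentiableAt.differentiableWithinAt
  obtain ⟨κ, hκ⟩ := isOpen_ball.exists_is_const_of_fderiv_eq_zero (convex_ball z r).isPreconnected hwd
    (fun x hx => (hwderiv x hx).fderiv)
  have heq : h =ᶠ[𝓝 z] fun x => (G x + (κ : ℂ)).re := by
    filter_upwards [ball_mem_nhds z hr] with x hx
    have := hκ x hx
    simp only [hw] at this
    simp only [Complex.add_re, Complex.ofReal_re]
    linarith
  have han : AnalyticAt ℂ (fun x => G x + (κ : ℂ)) z :=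
    (DifferentiableOn.analyticAt (fun x hx => (hG x hx).differentiableAt.differentiableWithinAt)
      (ball_mem_nhds z hr)).add analyticAt_const
  rw [harmonicAt_congr_nhds heq]
  exact han.harmonicAt_re

/-! ### 1. The candidate primitives `-G_ℍ(·;a) + c G_ℍ(·;b)` and their gradients -/

/-- `P_c(w) = log|w-a| - log|w-ā| - c (log|w-b| - log|w-b̄|) = -G_ℍ(w;a) + c G_ℍ(w;b)`: the
harmonic functions on `ℍ ∖ {a,b}` vanishing on `∂ℍ` with the singularities `log|w-a|` at `a` and
`-c log|w-b|` at `b`; `P_{𝓑²} = h_{[ℍ,a;b]}` (`spinorPrimCHI`).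
[cite: ChelkakHonglerIzyurovAnnals2015, Prop. 3.9 and Appendix (proof of Prop. 4.1: h = Re∫f² = G_ℍ(·;a) - Σ β_s² G_ℍ(·;a_s))] -/
def greenComboCHI (a b : ℂ) (c : ℝ) (w : ℂ) : ℝ :=
  Real.log ‖w - a‖ - Real.log ‖w - conj a‖ - c * (Real.log ‖w - b‖ - Real.log ‖w - conj b‖)

/-- `Q_c(w) = 1/(w-a) - 1/(w-ā) - c (1/(w-b) - 1/(w-b̄)) = 2∂_w P_c`; `Q_{𝓑²} = f_{[ℍ,a;b]}²`
(`spinorSqCHI_eq_partialFraction`). [cite: ChelkakHonglerIzyurovAnnals2015, §2.7.2 eq. (2.21) and Appendix (proof of Prop. 4.1)] -/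
def greenComboSqCHI (a b : ℂ) (c : ℝ) (w : ℂ) : ℂ :=
  1 / (w - a) - 1 / (w - conj a) - ((c : ℝ) : ℂ) * (1 / (w - b) - 1 / (w - conj b))

/-- `h_{[ℍ,a;b]} = P_{𝓑²}`. [cite: ChelkakHonglerIzyurovAnnals2015, Prop. 3.9] -/
theorem spinorPrimCHI_eq_greenComboCHI (a b : ℂ) : spinorPrimCHI a b = greenComboCHI a b (bCHI a b ^ 2) := rfl

/-- `f_{[ℍ,a;b]}² = Q_{𝓑²}` off the four poles. [cite: ChelkakHonglerIzyurovAnnals2015, §2.7.2 eq. (2.21)] -/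
theorem spinorSqCHI_eq_greenComboSqCHI {a b : ℂ} (ha : 0 < a.im) (hb : 0 < b.im) (hab : a ≠ b) {z : ℂ}
    (hza : z ≠ a) (hza' : z ≠ conj a) (hzb : z ≠ b) (hzb' : z ≠ conj b) :
    spinorSqCHI a b z = greenComboSqCHI a b (bCHI a b ^ 2) z :=
  spinorSqCHI_eq_partialFraction ha hb hab hza hza' hzb hzb'

/-- `dP_c = Re(Q_c dw)` off `{a, ā, b, b̄}`. [cite: ChelkakHonglerIzyurovAnnals2015, Prop. 3.9 (h := Re ∫ f² dz)] -/
theorem hasFDerivAt_greenComboCHI {a b : ℂ} (c : ℝ) {z : ℂ} (hza : z ≠ a) (hza' : z ≠ conj a) (hzb : z ≠ b)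
    (hzb' : z ≠ conj b) : HasFDerivAt (greenComboCHI a b c) (reMul (greenComboSqCHI a b c z)) z := by
  have h := ((hasFDerivAt_log_norm_sub hza).sub (hasFDerivAt_log_norm_sub hza')).sub
    (((hasFDerivAt_log_norm_sub hzb).sub (hasFDerivAt_log_norm_sub hzb')).const_smul c)
  have h' : HasFDerivAt (greenComboCHI a b c) _ z := h
  refine h'.congr_fderiv ?_
  rw [reMul_sub, reMul_sub, smul_reMul, reMul_sub]
  unfold greenComboSqCHI
  congr 1
  simp only [one_div]

/-- `Q_c` is complex differentiable off its four poles. [folklore] -/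
theorem differentiableAt_greenComboSqCHI {a b : ℂ} (c : ℝ) {z : ℂ} (hza : z ≠ a) (hza' : z ≠ conj a)
    (hzb : z ≠ b) (hzb' : z ≠ conj b) : DifferentiableAt ℂ (greenComboSqCHI a b c) z := by
  unfold greenComboSqCHI
  have h1 : z - a ≠ 0 := sub_ne_zero.2 hza
  have h2 : z - conj a ≠ 0 := sub_ne_zero.2 hza'
  have h3 : z - b ≠ 0 := sub_ne_zero.2 hzb
  have h4 : z - conj b ≠ 0 := sub_ne_zero.2 hzb'
  have e1 : DifferentiableAt ℂ (fun w : ℂ => 1 / (w - a)) z :=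
    (differentiableAt_const _).div (differentiableAt_id.sub_const a) h1
  have e2 : DifferentiableAt ℂ (fun w : ℂ => 1 / (w - conj a)) z :=
    (differentiableAt_const _).div (differentiableAt_id.sub_const (conj a)) h2
  have e3 : DifferentiableAt ℂ (fun w : ℂ => 1 / (w - b)) z :=
    (differentiableAt_const _).div (differentiableAt_id.sub_const b) h3
  have e4 : DifferentiableAt ℂ (fun w : ℂ => 1 / (w - conj b)) z :=
    (differentiableAt_const _).div (differentiableAt_id.sub_const (conj b)) h4
  exact (e1.sub e2).sub ((differentiableAt_const _).mul (e3.sub e4))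

/-- **Dirichlet boundary values**: `P_c = 0` on `∂ℍ = ℝ`. [cite: ChelkakHonglerIzyurovAnnals2015, Prop. 3.9 (1)] -/
theorem greenComboCHI_ofReal (a b : ℂ) (c : ℝ) (x : ℝ) : greenComboCHI a b c x = 0 := by
  have h1 : ‖(x : ℂ) - conj a‖ = ‖(x : ℂ) - a‖ := by
    rw [show (x : ℂ) - conj a = conj ((x : ℂ) - a) by rw [map_sub, Complex.conj_ofReal], Complex.norm_conj]
  have h2 : ‖(x : ℂ) - conj b‖ = ‖(x : ℂ) - b‖ := by
    rw [show (x : ℂ) - conj b = conj ((x : ℂ) - b) by rw [map_sub, Complex.conj_ofReal], Complex.norm_conj]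
  simp [greenComboCHI, h1, h2]

/-- A point of `ℍ̄ ∪` (small strip) is none of `a, ā, b, b̄` when its imaginary part is small:
if `|Im z| < min(Im a, Im b)` then `z ∉ {a, ā, b, b̄}`. [folklore] -/
theorem ne_four_of_abs_im_lt {a b z : ℂ} (hz : |z.im| < min a.im b.im) :
    z ≠ a ∧ z ≠ conj a ∧ z ≠ b ∧ z ≠ conj b := by
  have ha : |z.im| < a.im := hz.trans_le (min_le_left _ _)
  have hb : |z.im| < b.im := hz.trans_le (min_le_right _ _)
  rw [abs_lt] at ha hb
  refine ⟨fun h => ?_, fun h => ?_, fun h => ?_, fun h => ?_⟩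
  · rw [h] at ha; linarith [ha.2]
  · rw [h, Complex.conj_im] at ha; linarith [ha.1]
  · rw [h] at hb; linarith [hb.2]
  · rw [h, Complex.conj_im] at hb; linarith [hb.1]

/-- `1/(x-a) - 1/(x-ā) = 2i Im a / |x-a|²` for real `x`. [folklore] -/
theorem inv_sub_sub_inv_sub_conj (a : ℂ) (x : ℝ) (h : (x : ℂ) ≠ a) :
    1 / ((x : ℂ) - a) - 1 / ((x : ℂ) - conj a) = ((2 * a.im / ‖(x : ℂ) - a‖ ^ 2 : ℝ) : ℂ) * I := by
  have hd : (x : ℂ) - a ≠ 0 := sub_ne_zero.2 h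
  have hconj : (x : ℂ) - conj a = conj ((x : ℂ) - a) := by rw [map_sub, Complex.conj_ofReal]
  have hd' : (x : ℂ) - conj a ≠ 0 := by rw [hconj]; exact (map_ne_zero _).2 hd
  have hn : ((‖(x : ℂ) - a‖ ^ 2 : ℝ) : ℂ) = ((x : ℂ) - a) * ((x : ℂ) - conj a) := by
    rw [hconj, Complex.mul_conj, Complex.normSq_eq_norm_sq]
  have hn0 : ((‖(x : ℂ) - a‖ ^ 2 : ℝ) : ℂ) ≠ 0 := by rw [hn]; exact mul_ne_zero hd hd'
  rw [div_sub_div _ _ hd hd', one_mul, mul_one, ← hn]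
  have hnum : ((x : ℂ) - conj a) - ((x : ℂ) - a) = a - conj a := by ring
  rw [hnum, Complex.sub_conj]
  push_cast
  field_simp

/-- **`Q_c` on the real axis**: `Q_c(x) = 2i (Im a/|x-a|² - c Im b/|x-b|²)`; in particular
`∂_y P_c(x) = -Im Q_c(x) = -2(Im a/|x-a|² - c Im b/|x-b|²)`. [folklore] -/
theorem greenComboSqCHI_ofReal {a b : ℂ} (ha : 0 < a.im) (hb : 0 < b.im) (c x : ℝ) :
    greenComboSqCHI a b c x =
      ((2 * (a.im / ‖(x : ℂ) - a‖ ^ 2 - c * (b.im / ‖(x : ℂ) - b‖ ^ 2)) : ℝ) : ℂ) * I := by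
  have hxa : (x : ℂ) ≠ a := fun h => by have := congrArg Complex.im h; simp at this; linarith
  have hxb : (x : ℂ) ≠ b := fun h => by have := congrArg Complex.im h; simp at this; linarith
  unfold greenComboSqCHI
  rw [inv_sub_sub_inv_sub_conj a x hxa, inv_sub_sub_inv_sub_conj b x hxb]
  push_cast
  ring

/-- **The boundary positivity of the true solution** ((2.6) for `f_{[ℍ,a;b]}`, `spinorSqCHI_boundary`):
`𝓑_ℍ(a;b)² · Im b/|x-b|² ≤ Im a/|x-a|²` for every real `x`, i.e. `∂_y h_{[ℍ,a;b]} ≤ 0` on `ℝ`.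
[cite: ChelkakHonglerIzyurovAnnals2015, Def. 2.8 eq. (2.6) and §2.7.2] -/
theorem sigma_bCHI_nonneg {a b : ℂ} (ha : 0 < a.im) (hb : 0 < b.im) (hab : a ≠ b) (x : ℝ) :
    0 ≤ a.im / ‖(x : ℂ) - a‖ ^ 2 - bCHI a b ^ 2 * (b.im / ‖(x : ℂ) - b‖ ^ 2) := by
  obtain ⟨t, ht, heq⟩ := spinorSqCHI_boundary ha hb x
  have hx : |((x : ℂ)).im| < min a.im b.im := by simp [lt_min ha hb]
  obtain ⟨h1, h2, h3, h4⟩ := ne_four_of_abs_im_lt hx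
  rw [spinorSqCHI_eq_greenComboSqCHI ha hb hab h1 h2 h3 h4, greenComboSqCHI_ofReal ha hb] at heq
  have : ((2 * (a.im / ‖(x : ℂ) - a‖ ^ 2 - bCHI a b ^ 2 * (b.im / ‖(x : ℂ) - b‖ ^ 2)) : ℝ) : ℂ) = t := by
    rw [← heq, mul_assoc, ← neg_mul_eq_mul_neg, Complex.I_mul_I, neg_neg, mul_one]
  have h2t : 2 * (a.im / ‖(x : ℂ) - a‖ ^ 2 - bCHI a b ^ 2 * (b.im / ‖(x : ℂ) - b‖ ^ 2)) = t := by
    exact_mod_cast this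
  linarith

/-- The square of the numerator of (2.21) on the real axis is `(2 Re(α(x-b)))²`, `α² = (b̄-ā)(b̄-a)`.
[cite: ChelkakHonglerIzyurovAnnals2015, §2.7.2 eq. (2.21)] -/
theorem spinorNumSq_ofReal_eq_sq {a b α : ℂ} (hα : α ^ 2 = spinorA2 a b) (x : ℝ) :
    spinorNumSq a b x = (((2 * (α * ((x : ℂ) - b)).re : ℝ)) : ℂ) ^ 2 := by
  rw [← spinorNumSq_eq_sq hα]
  congr 1
  have : conj α * ((x : ℂ) - conj b) = conj (α * ((x : ℂ) - b)) := by
    rw [map_mul, map_sub, Complex.conj_ofReal]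
  rw [this, Complex.add_conj]

/-- **`∂_y h_{[ℍ,a;b]}` on `ℝ` in closed form**: with `L(x) = 2 Re(α(x-b))`,
`Im a/|x-a|² - 𝓑² Im b/|x-b|² = Im a · L(x)² / ((|b-ā|+|b-a|)² |x-a|² |x-b|²)` — a perfect square,
vanishing at the real zero of `L` (the double root of `f²ν` on `∂ℍ`). [cite: ChelkakHonglerIzyurovAnnals2015, §2.7.2 eq. (2.21) and Def. 2.8 eq. (2.6)] -/
theorem sigma_bCHI_eq {a b α : ℂ} (ha : 0 < a.im) (hb : 0 < b.im) (hab : a ≠ b) (hα : α ^ 2 = spinorA2 a b)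
    (x : ℝ) :
    a.im / ‖(x : ℂ) - a‖ ^ 2 - bCHI a b ^ 2 * (b.im / ‖(x : ℂ) - b‖ ^ 2) =
      a.im * (2 * (α * ((x : ℂ) - b)).re) ^ 2 /
        ((‖b - conj a‖ + ‖b - a‖) ^ 2 * ‖(x : ℂ) - a‖ ^ 2 * ‖(x : ℂ) - b‖ ^ 2) := by
  have hx : |((x : ℂ)).im| < min a.im b.im := by simp [lt_min ha hb]
  obtain ⟨h1, h2, h3, h4⟩ := ne_four_of_abs_im_lt hx
  obtain ⟨-, -, -, -, -, hS⟩ := spinor_ne_zero_aux ha hb hab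
  have hda : 0 < ‖(x : ℂ) - a‖ := norm_pos_iff.2 (sub_ne_zero.2 h1)
  have hdb : 0 < ‖(x : ℂ) - b‖ := norm_pos_iff.2 (sub_ne_zero.2 h3)
  -- evaluate `f²(x)` from the definition
  have hxa : ((x : ℂ) - a) * ((x : ℂ) - conj a) = ((‖(x : ℂ) - a‖ ^ 2 : ℝ) : ℂ) := by
    rw [show (x : ℂ) - conj a = conj ((x : ℂ) - a) by rw [map_sub, Complex.conj_ofReal], Complex.mul_conj,
      Complex.normSq_eq_norm_sq]
  have hxb : ((x : ℂ) - b) * ((x : ℂ) - conj b) = ((‖(x : ℂ) - b‖ ^ 2 : ℝ) : ℂ) := by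
    rw [show (x : ℂ) - conj b = conj ((x : ℂ) - b) by rw [map_sub, Complex.conj_ofReal], Complex.mul_conj,
      Complex.normSq_eq_norm_sq]
  set L : ℝ := 2 * (α * ((x : ℂ) - b)).re with hL
  have hdef : spinorSqCHI a b x =
      ((2 * a.im * L ^ 2 / ((‖b - conj a‖ + ‖b - a‖) ^ 2 * (‖(x : ℂ) - a‖ ^ 2 * ‖(x : ℂ) - b‖ ^ 2)) : ℝ) : ℂ) * I := by
    unfold spinorSqCHI spinorC2
    rw [spinorNumSq_ofReal_eq_sq hα x, ← hL,
      show ((x : ℂ) - a) * ((x : ℂ) - conj a) * ((x : ℂ) - b) * ((x : ℂ) - conj b) =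
        ((‖(x : ℂ) - a‖ ^ 2 : ℝ) : ℂ) * ((‖(x : ℂ) - b‖ ^ 2 : ℝ) : ℂ) by rw [← hxa, ← hxb]; ring,
      Complex.sub_conj]
    have hS' : ((‖b - conj a‖ + ‖b - a‖ : ℝ) : ℂ) ≠ 0 := by exact_mod_cast hS.ne'
    have hda' : ((‖(x : ℂ) - a‖ : ℝ) : ℂ) ≠ 0 := by exact_mod_cast hda.ne'
    have hdb' : ((‖(x : ℂ) - b‖ : ℝ) : ℂ) ≠ 0 := by exact_mod_cast hdb.ne'
    push_cast
    field_simp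
  -- compare with the partial-fraction evaluation
  have hpf := spinorSqCHI_eq_greenComboSqCHI ha hb hab h1 h2 h3 h4
  rw [greenComboSqCHI_ofReal ha hb, hdef] at hpf
  have hI : (I : ℂ) ≠ 0 := I_ne_zero
  have := mul_right_cancel₀ hI hpf
  have hreal : 2 * a.im * L ^ 2 / ((‖b - conj a‖ + ‖b - a‖) ^ 2 * (‖(x : ℂ) - a‖ ^ 2 * ‖(x : ℂ) - b‖ ^ 2)) =
      2 * (a.im / ‖(x : ℂ) - a‖ ^ 2 - bCHI a b ^ 2 * (b.im / ‖(x : ℂ) - b‖ ^ 2)) := by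
    exact_mod_cast this
  have hden : 0 < (‖b - conj a‖ + ‖b - a‖) ^ 2 * ‖(x : ℂ) - a‖ ^ 2 * ‖(x : ℂ) - b‖ ^ 2 := by positivity
  rw [eq_div_iff hden.ne']
  have := hreal
  rw [div_eq_iff (by positivity)] at this
  nlinarith [this]

/-- `inf_x (px+q)²/((x-s)²+t) = 0` for `t > 0`: a real linear form vanishes somewhere or is constant.
[folklore] -/
theorem exists_linear_sq_div_lt (p q s : ℝ) {t ε : ℝ} (ht : 0 < t) (hε : 0 < ε) :
    ∃ x : ℝ, (p * x + q) ^ 2 / ((x - s) ^ 2 + t) < ε := by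
  by_cases hp : p = 0
  · subst hp
    refine ⟨s + (q ^ 2 / ε + 1), ?_⟩
    rw [zero_mul, zero_add, add_sub_cancel_left, div_lt_iff₀ (by positivity)]
    have h1 : q ^ 2 / ε + 1 ≤ (q ^ 2 / ε + 1) ^ 2 := by
      have : 1 ≤ q ^ 2 / ε + 1 := by have := div_nonneg (sq_nonneg q) hε.le; linarith
      nlinarith
    have h2 : q ^ 2 = ε * (q ^ 2 / ε) := by field_simp
    nlinarith
  · refine ⟨-q / p, ?_⟩
    have : p * (-q / p) + q = 0 := by field_simp; ring
    rw [this]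
    simp only [ne_eq, OfNat.ofNat_ne_zero, not_false_eq_true, zero_pow, zero_div]
    exact hε

/-- **`𝓑_ℍ(a;b)²` is the largest admissible residue at `b`**: for `c > 𝓑²` there is a real `x₀` with
`Im a/|x₀-a|² - c Im b/|x₀-b|² < 0`, i.e. `∂_y P_c(x₀) > 0` (the perfect square
`∂_y h_{[ℍ,a;b]}` gets arbitrarily small relative to `Im b/|x-b|²`). [cite: ChelkakHonglerIzyurovAnnals2015, §2.7.2 (𝓑_ℍ from the expansion at b) and Def. 2.8 eq. (2.6)] -/
theorem exists_sigma_neg {a b : ℂ} (ha : 0 < a.im) (hb : 0 < b.im) (hab : a ≠ b) {c : ℝ} (hc : bCHI a b ^ 2 < c) :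
    ∃ x : ℝ, a.im / ‖(x : ℂ) - a‖ ^ 2 - c * (b.im / ‖(x : ℂ) - b‖ ^ 2) < 0 := by
  obtain ⟨α, hα⟩ : ∃ α : ℂ, α ^ 2 = spinorA2 a b := ⟨(spinorA2 a b) ^ ((2 : ℂ)⁻¹), cpow_two_inv_sq _⟩
  obtain ⟨-, -, -, -, -, hS⟩ := spinor_ne_zero_aux ha hb hab
  set S : ℝ := ‖b - conj a‖ + ‖b - a‖ with hSdef
  -- `L(x) = 2 Re(α(x-b)) = p x + q`
  set p : ℝ := 2 * α.re with hp
  set q : ℝ := -(2 * (α * b).re) with hq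
  have hL : ∀ x : ℝ, 2 * (α * ((x : ℂ) - b)).re = p * x + q := by
    intro x
    simp only [hp, hq, mul_sub, Complex.sub_re, Complex.mul_re, Complex.ofReal_re, Complex.ofReal_im, mul_zero,
      sub_zero]
    ring
  set ε : ℝ := (c - bCHI a b ^ 2) * b.im * S ^ 2 / a.im with hε
  have hε0 : 0 < ε := by
    have : 0 < c - bCHI a b ^ 2 := by linarith
    positivity
  obtain ⟨x, hx⟩ := exists_linear_sq_div_lt p q a.re (pow_pos ha 2) hε0
  refine ⟨x, ?_⟩
  have hxim : |((x : ℂ)).im| < min a.im b.im := by simp [lt_min ha hb]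
  obtain ⟨h1, -, h3, -⟩ := ne_four_of_abs_im_lt hxim
  have hda : 0 < ‖(x : ℂ) - a‖ := norm_pos_iff.2 (sub_ne_zero.2 h1)
  have hdb : 0 < ‖(x : ℂ) - b‖ := norm_pos_iff.2 (sub_ne_zero.2 h3)
  have hnorma : ‖(x : ℂ) - a‖ ^ 2 = (x - a.re) ^ 2 + a.im ^ 2 := by
    rw [Complex.sq_norm, Complex.normSq_apply]
    simp
    ring
  have hsig := sigma_bCHI_eq ha hb hab hα x
  rw [hL x] at hsig
  -- `σ_c = σ_{𝓑²} - (c - 𝓑²) Im b/|x-b|²`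
  have hsplit : a.im / ‖(x : ℂ) - a‖ ^ 2 - c * (b.im / ‖(x : ℂ) - b‖ ^ 2) =
      (a.im / ‖(x : ℂ) - a‖ ^ 2 - bCHI a b ^ 2 * (b.im / ‖(x : ℂ) - b‖ ^ 2)) -
        (c - bCHI a b ^ 2) * (b.im / ‖(x : ℂ) - b‖ ^ 2) := by ring
  rw [hsplit, hsig, ← hSdef, hnorma]
  have hpos : 0 < (x - a.re) ^ 2 + a.im ^ 2 := by positivity
  rw [div_lt_iff₀ hpos, hε] at hx
  have hane : a.im ≠ 0 := ha.ne'
  have hxb2 : 0 < ‖(x : ℂ) - b‖ ^ 2 := pow_pos hdb 2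
  have hA : 0 < S ^ 2 * ((x - a.re) ^ 2 + a.im ^ 2) := by positivity
  have hbr : a.im * (p * x + q) ^ 2 / (S ^ 2 * ((x - a.re) ^ 2 + a.im ^ 2)) < (c - bCHI a b ^ 2) * b.im := by
    rw [div_lt_iff₀ hA]
    have h1 := mul_lt_mul_of_pos_left hx ha
    have h' : a.im * ((c - bCHI a b ^ 2) * b.im * S ^ 2 / a.im * ((x - a.re) ^ 2 + a.im ^ 2)) =
        (c - bCHI a b ^ 2) * b.im * (S ^ 2 * ((x - a.re) ^ 2 + a.im ^ 2)) := by
      field_simp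
    linarith [h']
  have hrew : a.im * (p * x + q) ^ 2 / (S ^ 2 * ((x - a.re) ^ 2 + a.im ^ 2) * ‖(x : ℂ) - b‖ ^ 2) -
      (c - bCHI a b ^ 2) * (b.im / ‖(x : ℂ) - b‖ ^ 2) =
      (a.im * (p * x + q) ^ 2 / (S ^ 2 * ((x - a.re) ^ 2 + a.im ^ 2)) - (c - bCHI a b ^ 2) * b.im) /
        ‖(x : ℂ) - b‖ ^ 2 := by
    rw [sub_div, div_mul_eq_div_div, ← mul_div_assoc]
  rw [hrew]
  exact div_neg_of_neg_of_pos (by linarith) hxb2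

/-- A real quadratic with negative leading coefficient takes a negative value. [folklore] -/
theorem exists_quadratic_neg {p : ℝ} (q r : ℝ) (hp : p < 0) : ∃ x : ℝ, p * x ^ 2 + q * x + r < 0 := by
  set x : ℝ := (|q| + |r|) / (-p) + 1 with hx
  refine ⟨x, ?_⟩
  have hx0 : 0 ≤ (|q| + |r|) / (-p) := div_nonneg (by positivity) (by linarith)
  have hx1 : 1 ≤ x := by rw [hx]; linarith
  have hp0 : p ≠ 0 := hp.ne
  have hpx : p * x + |q| + |r| = p := by
    rw [hx]
    field_simp
    ring
  have h1 : q * x ≤ |q| * x := by nlinarith [le_abs_self q]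
  have h2 : r ≤ |r| * x := by nlinarith [le_abs_self r, abs_nonneg r]
  calc p * x ^ 2 + q * x + r ≤ p * x ^ 2 + |q| * x + |r| * x := by linarith
    _ = x * (p * x + |q| + |r|) := by ring
    _ = x * p := by rw [hpx]
    _ < 0 := mul_neg_of_pos_of_neg (by linarith) hp

/-! ### 2. The three exclusions of the boundary analysis -/

/-- **`c > 𝓑²` is excluded by (2)**: if `Im Q_c(x₀) < 0` at a real point, i.e. `∂_y P_c(x₀) > 0`, then
`P_c > 0` on a half-disc `{|w - x₀| < r, Im w > 0}` (mean value theorem in `y`; `P_c = 0` on `ℝ`).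
[cite: ChelkakHonglerIzyurovAnnals2015, Prop. 3.9 (2) ("(2.6) is equivalent to (1) and (2): … ∂_ν h ≥ 0")] -/
theorem greenComboCHI_pos_of_im_neg {a b : ℂ} (ha : 0 < a.im) (hb : 0 < b.im) {c : ℝ} {x₀ : ℝ}
    (hneg : (greenComboSqCHI a b c x₀).im < 0) :
    ∃ r > 0, r ≤ min a.im b.im ∧ ∀ w : ℂ, dist w x₀ < r → 0 < w.im → 0 < greenComboCHI a b c w := by
  have hx₀ : |((x₀ : ℂ)).im| < min a.im b.im := by simp [lt_min ha hb]
  obtain ⟨h1, h2, h3, h4⟩ := ne_four_of_abs_im_lt hx₀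
  have hcont : ContinuousAt (greenComboSqCHI a b c) x₀ := (differentiableAt_greenComboSqCHI c h1 h2 h3 h4).continuousAt
  have hev : ∀ᶠ w in 𝓝 (x₀ : ℂ), (greenComboSqCHI a b c w).im < 0 :=
    (Complex.continuous_im.continuousAt.comp hcont).tendsto.eventually (Iio_mem_nhds hneg)
  obtain ⟨r₀, hr₀, hball⟩ := Metric.eventually_nhds_iff_ball.1 hev
  set r : ℝ := min r₀ (min a.im b.im) with hr
  have hr0 : 0 < r := lt_min hr₀ (lt_min ha hb)
  refine ⟨r, hr0, min_le_right _ _, fun w hw hwim => ?_⟩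
  -- the vertical segment from `Re w` to `w`
  set pt : ℝ → ℂ := fun t => (w.re : ℂ) + (t : ℂ) * I with hpt
  have hpt_im : ∀ t : ℝ, (pt t).im = t := fun t => by simp [hpt]
  have hpt_re : ∀ t : ℝ, (pt t).re = w.re := fun t => by simp [hpt]
  have hseg : ∀ t ∈ Icc 0 w.im, pt t ∈ ball (x₀ : ℂ) r₀ ∧ |(pt t).im| < min a.im b.im := by
    intro t ht
    have hdist : dist (pt t) x₀ ≤ dist w x₀ := by
      rw [dist_eq_norm, dist_eq_norm, Complex.norm_def, Complex.norm_def, Real.sqrt_le_sqrt_iff (normSq_nonneg _),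
        Complex.normSq_apply, Complex.normSq_apply]
      simp only [Complex.sub_re, hpt_re, Complex.ofReal_re, Complex.sub_im, hpt_im, Complex.ofReal_im, sub_zero]
      nlinarith [ht.1, ht.2]
    have hr' : dist w x₀ < r := hw
    refine ⟨mem_ball.2 (lt_of_le_of_lt hdist (hr'.trans_le (min_le_left _ _))), ?_⟩
    rw [hpt_im, abs_of_nonneg ht.1]
    have : w.im < min a.im b.im := by
      have h1 : |w.im| ≤ ‖w - x₀‖ := by simpa using abs_im_le_norm (w - x₀)
      rw [abs_of_pos hwim] at h1
      rw [dist_eq_norm] at hr'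
      exact lt_of_le_of_lt h1 (hr'.trans_le (min_le_right _ _))
    exact lt_of_le_of_lt ht.2 this
  -- the function along the segment and its derivative
  set φ : ℝ → ℝ := fun t => greenComboCHI a b c (pt t) with hφ
  set φ' : ℝ → ℝ := fun t => -(greenComboSqCHI a b c (pt t)).im with hφ'
  have hderiv : ∀ t ∈ Icc 0 w.im, HasDerivAt φ (φ' t) t := by
    intro t ht
    obtain ⟨k1, k2, k3, k4⟩ := ne_four_of_abs_im_lt (hseg t ht).2
    have hline : HasDerivAt pt I t := by
      have := (((hasDerivAt_id t).ofReal_comp).mul_const I).const_add (w.re : ℂ)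
      simpa [hpt] using this
    have h := (hasFDerivAt_greenComboCHI c k1 k2 k3 k4).comp_hasDerivAt t hline
    refine h.congr_deriv ?_
    rw [reMul_apply, hφ']
    simp [Complex.mul_re]
  have hcontφ : ContinuousOn φ (Icc 0 w.im) := fun t ht => (hderiv t ht).continuousAt.continuousWithinAt
  obtain ⟨ξ, hξ, hslope⟩ := exists_hasDerivAt_eq_slope φ φ' hwim hcontφ (fun t ht => hderiv t (Ioo_subset_Icc_self ht))
  have hφ0 : φ 0 = 0 := by
    simp only [hφ, hpt, Complex.ofReal_zero, zero_mul, add_zero]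
    exact greenComboCHI_ofReal a b c w.re
  have hφ1 : φ w.im = greenComboCHI a b c w := by
    simp only [hφ, hpt, Complex.re_add_im]
  have hξpos : 0 < φ' ξ := by
    have := hball _ (hseg ξ (Ioo_subset_Icc_self hξ)).1
    rw [hφ']
    linarith
  rw [hslope, hφ0, hφ1, sub_zero, sub_zero] at hξpos
  exact (div_pos_iff_of_pos_right hwim).1 hξpos

/-- **`0 < c < 𝓑²` is excluded by the spinor structure**: then `Q_c` has a simple zero in
`ℍ ∖ {a, b}` (its numerator is a real quadratic, positive on `ℝ` by the boundary positivity of the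
true solution, with a pair of conjugate simple roots), where no holomorphic square root exists.
[cite: ChelkakHonglerIzyurovAnnals2015, Def. 2.8 ("holomorphic spinor … branching around each of a, b") and Remark 2.9 (i)] -/
theorem exists_simpleZero_greenComboSq {a b : ℂ} (ha : 0 < a.im) (hb : 0 < b.im) (hab : a ≠ b) {c : ℝ}
    (hc0 : 0 < c) (hc : c < bCHI a b ^ 2) :
    ∃ z : ℂ, 0 < z.im ∧ z ≠ a ∧ z ≠ b ∧ greenComboSqCHI a b c z = 0 ∧ deriv (greenComboSqCHI a b c) z ≠ 0 := by
  obtain ⟨hane, hba, hba', hba'', hbne, hS⟩ := spinor_ne_zero_aux ha hb hab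
  -- the quadratic forms `m_{c'}(x) = Im a |x-b|² - c' Im b |x-a|²`
  have hquad : ∀ (c' : ℝ) (x : ℝ), a.im * ‖(x : ℂ) - b‖ ^ 2 - c' * b.im * ‖(x : ℂ) - a‖ ^ 2 =
      (a.im - c' * b.im) * x ^ 2 + (-(2 * (a.im * b.re - c' * b.im * a.re))) * x +
        (a.im * (b.re ^ 2 + b.im ^ 2) - c' * b.im * (a.re ^ 2 + a.im ^ 2)) := by
    intro c' x
    rw [Complex.sq_norm, Complex.sq_norm, Complex.normSq_apply, Complex.normSq_apply]
    simp
    ring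
  have hnn : ∀ x : ℝ, 0 ≤ a.im * ‖(x : ℂ) - b‖ ^ 2 - bCHI a b ^ 2 * b.im * ‖(x : ℂ) - a‖ ^ 2 := by
    intro x
    have h := sigma_bCHI_nonneg ha hb hab x
    have hxim : |((x : ℂ)).im| < min a.im b.im := by simp [lt_min ha hb]
    obtain ⟨h1, -, h3, -⟩ := ne_four_of_abs_im_lt hxim
    have hda : 0 < ‖(x : ℂ) - a‖ ^ 2 := pow_pos (norm_pos_iff.2 (sub_ne_zero.2 h1)) 2
    have hdb : 0 < ‖(x : ℂ) - b‖ ^ 2 := pow_pos (norm_pos_iff.2 (sub_ne_zero.2 h3)) 2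
    rw [sub_nonneg, ← mul_div_assoc, div_le_div_iff₀ hdb hda] at h
    linarith
  have hposx : ∀ x : ℝ, 0 < a.im * ‖(x : ℂ) - b‖ ^ 2 - c * b.im * ‖(x : ℂ) - a‖ ^ 2 := by
    intro x
    have hxim : |((x : ℂ)).im| < min a.im b.im := by simp [lt_min ha hb]
    obtain ⟨h1, -, -, -⟩ := ne_four_of_abs_im_lt hxim
    have hda : 0 < ‖(x : ℂ) - a‖ ^ 2 := pow_pos (norm_pos_iff.2 (sub_ne_zero.2 h1)) 2
    have := hnn x
    have h2 : c * b.im * ‖(x : ℂ) - a‖ ^ 2 < bCHI a b ^ 2 * b.im * ‖(x : ℂ) - a‖ ^ 2 := by gcongr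
    linarith
  set α : ℝ := a.im - c * b.im with hαdef
  set β : ℝ := a.im * b.re - c * b.im * a.re with hβdef
  set γ : ℝ := a.im * (b.re ^ 2 + b.im ^ 2) - c * b.im * (a.re ^ 2 + a.im ^ 2) with hγdef
  have hpos : ∀ x : ℝ, 0 < α * x ^ 2 + (-(2 * β)) * x + γ := fun x => by
    have := hposx x
    rw [hquad c x] at this
    exact this
  -- the leading coefficient is positive
  have hα0 : 0 < α := by
    rcases lt_trichotomy α 0 with hlt | heq | hgt
    · obtain ⟨x, hx⟩ := exists_quadratic_neg (-(2 * β)) γ hlt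
      linarith [hpos x]
    · exfalso
      -- `α = 0`: then `β = 0` (a non-constant linear form takes negative values) ...
      have hβ : β = 0 := by
        by_contra hβ
        have := hpos ((γ + 1) / (2 * β))
        rw [heq, zero_mul, zero_add] at this
        have : -(2 * β) * ((γ + 1) / (2 * β)) + γ = -1 := by field_simp; ring
        linarith
      -- ... and the true residue `𝓑²` would violate the boundary positivity (leading coefficient `(c-𝓑²) Im b < 0`)
      have hlead : a.im - bCHI a b ^ 2 * b.im < 0 := by
        have : a.im = c * b.im := by linarith [heq]
        rw [this]
        nlinarith
      obtain ⟨x, hx⟩ := exists_quadratic_neg (-(2 * (a.im * b.re - bCHI a b ^ 2 * b.im * a.re)))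
        (a.im * (b.re ^ 2 + b.im ^ 2) - bCHI a b ^ 2 * b.im * (a.re ^ 2 + a.im ^ 2)) hlead
      have := hnn x
      rw [hquad] at this
      linarith
    · exact hgt
  -- negative discriminant
  set δ : ℝ := α * γ - β ^ 2 with hδdef
  have hδ : 0 < δ := by
    have := hpos (β / α)
    have h1 : α * (β / α) ^ 2 + (-(2 * β)) * (β / α) + γ = (α * γ - β ^ 2) / α := by
      field_simp
      ring
    rw [h1] at this
    exact (div_pos_iff_of_pos_right hα0).1 this
  set s : ℝ := Real.sqrt δ with hsdef
  have hs0 : 0 < s := Real.sqrt_pos.2 hδ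
  have hs2 : s ^ 2 = δ := Real.sq_sqrt hδ.le
  -- the root `z = (β + i s)/α`
  set z : ℂ := ((β : ℂ) + (s : ℂ) * I) / (α : ℂ) with hzdef
  have hzim : z.im = s / α := by
    rw [hzdef, Complex.div_ofReal_im]
    simp
  have hzim0 : 0 < z.im := by rw [hzim]; positivity
  -- the numerator and its identity with `Q_c`
  set Nt : ℂ → ℂ := fun w => (α : ℂ) * w ^ 2 - 2 * (β : ℂ) * w + (γ : ℂ) with hNtdef
  have hNtprod : ∀ w, Nt w = (a.im : ℂ) * ((w - b) * (w - conj b)) - (c : ℂ) * b.im * ((w - a) * (w - conj a)) := by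
    intro w
    have hb2 : (w - b) * (w - conj b) = w ^ 2 - 2 * (b.re : ℂ) * w + ((b.re ^ 2 + b.im ^ 2 : ℝ) : ℂ) := by
      have e1 : b + conj b = ((2 * b.re : ℝ) : ℂ) := Complex.add_conj b
      have e2 : b * conj b = ((b.re ^ 2 + b.im ^ 2 : ℝ) : ℂ) := by
        apply Complex.ext <;> simp [sq]; ring
      calc (w - b) * (w - conj b) = w ^ 2 - (b + conj b) * w + b * conj b := by ring
        _ = _ := by rw [e1, e2]; push_cast; ring
    have ha2 : (w - a) * (w - conj a) = w ^ 2 - 2 * (a.re : ℂ) * w + ((a.re ^ 2 + a.im ^ 2 : ℝ) : ℂ) := by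
      have e1 : a + conj a = ((2 * a.re : ℝ) : ℂ) := Complex.add_conj a
      have e2 : a * conj a = ((a.re ^ 2 + a.im ^ 2 : ℝ) : ℂ) := by
        apply Complex.ext <;> simp [sq]; ring
      calc (w - a) * (w - conj a) = w ^ 2 - (a + conj a) * w + a * conj a := by ring
        _ = _ := by rw [e1, e2]; push_cast; ring
    rw [hb2, ha2, hNtdef, hαdef, hβdef, hγdef]
    push_cast
    ring
  set Den : ℂ → ℂ := fun w => (w - a) * (w - conj a) * (w - b) * (w - conj b) with hDendef
  have hQ : ∀ w : ℂ, w ≠ a → w ≠ conj a → w ≠ b → w ≠ conj b →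
      greenComboSqCHI a b c w = 2 * I * Nt w / Den w := by
    intro w k1 k2 k3 k4
    have d1 : w - a ≠ 0 := sub_ne_zero.2 k1
    have d2 : w - conj a ≠ 0 := sub_ne_zero.2 k2
    have d3 : w - b ≠ 0 := sub_ne_zero.2 k3
    have d4 : w - conj b ≠ 0 := sub_ne_zero.2 k4
    have hsa : a - conj a = 2 * (a.im : ℂ) * I := by rw [Complex.sub_conj]; push_cast; ring
    have hsb : b - conj b = 2 * (b.im : ℂ) * I := by rw [Complex.sub_conj]; push_cast; ring
    rw [hNtprod, hDendef]
    unfold greenComboSqCHI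
    rw [div_sub_div _ _ d1 d2, div_sub_div _ _ d3 d4, one_mul, mul_one, one_mul, mul_one,
      show w - conj a - (w - a) = a - conj a by ring, show w - conj b - (w - b) = b - conj b by ring, hsa, hsb]
    field_simp
  -- `Nt z = 0`, `Nt' z ≠ 0`
  have hα0' : (α : ℂ) ≠ 0 := by exact_mod_cast hα0.ne'
  have hsC : (s : ℂ) ^ 2 = (δ : ℂ) := by exact_mod_cast hs2
  set u : ℂ := (β : ℂ) + (s : ℂ) * I with hudef
  have hzu : z = u / α := by rw [hzdef]
  have hαz : (α : ℂ) * z = u := by rw [hzu]; field_simp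
  have hu : u ^ 2 - 2 * β * u + α * γ = 0 := by
    have hub : u - β = s * I := by rw [hudef]; ring
    have hδC : (δ : ℂ) = α * γ - β ^ 2 := by rw [hδdef]; push_cast; ring
    calc u ^ 2 - 2 * β * u + α * γ = (u - β) ^ 2 + (α * γ - β ^ 2) := by ring
      _ = (s * I) ^ 2 + δ := by rw [hub, hδC]
      _ = 0 := by rw [mul_pow, Complex.I_sq, hsC]; ring
  have hNtz : Nt z = 0 := by
    have : Nt z = (u ^ 2 - 2 * β * u + α * γ) / α := by
      simp only [hNtdef, hzu]
      field_simp
    rw [this, hu, zero_div]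
  have hNt'z : 2 * (α : ℂ) * z - 2 * β = 2 * (s : ℂ) * I := by
    rw [mul_assoc, hαz, hudef]
    ring
  have hNt'ne : 2 * (α : ℂ) * z - 2 * β ≠ 0 := by
    rw [hNt'z]
    have : (s : ℂ) ≠ 0 := by exact_mod_cast hs0.ne'
    simp [this, I_ne_zero]
  -- `z` avoids the poles
  have hza : z ≠ a := by
    intro h
    have := hNtz
    rw [hNtprod, h, sub_self, zero_mul, mul_zero, sub_zero] at this
    have hane' : (a.im : ℂ) ≠ 0 := by exact_mod_cast ha.ne'
    simp only [mul_eq_zero, hane', false_or, sub_eq_zero] at this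
    rcases this with h1 | h1
    · exact hab h1
    · exact hba' (by rw [h1]; ring)
  have hzb : z ≠ b := by
    intro h
    have := hNtz
    rw [hNtprod, h, sub_self, zero_mul, mul_zero, zero_sub, neg_eq_zero] at this
    have hc' : (c : ℂ) ≠ 0 := by exact_mod_cast hc0.ne'
    have hbim : (b.im : ℂ) ≠ 0 := by exact_mod_cast hb.ne'
    simp only [mul_eq_zero, hc', hbim, false_or, sub_eq_zero, or_false] at this
    rcases this with h1 | h1
    · exact hba (sub_eq_zero.2 h1)
    · exact hba'' (sub_eq_zero.2 h1)
  have hza' : z ≠ conj a := fun h => by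
    have := congrArg Complex.im h
    rw [Complex.conj_im] at this
    linarith
  have hzb' : z ≠ conj b := fun h => by
    have := congrArg Complex.im h
    rw [Complex.conj_im] at this
    linarith
  have hDenz : Den z ≠ 0 := by
    simp only [hDendef]
    exact mul_ne_zero (mul_ne_zero (mul_ne_zero (sub_ne_zero.2 hza) (sub_ne_zero.2 hza')) (sub_ne_zero.2 hzb))
      (sub_ne_zero.2 hzb')
  refine ⟨z, hzim0, hza, hzb, by rw [hQ z hza hza' hzb hzb', hNtz]; simp, ?_⟩
  -- the derivative at `z`: quotient rule at a zero of the numerator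
  have hev : greenComboSqCHI a b c =ᶠ[𝓝 z] fun w => 2 * I * Nt w / Den w := by
    filter_upwards [eventually_ne_nhds hza, eventually_ne_nhds hza', eventually_ne_nhds hzb, eventually_ne_nhds hzb']
      with w k1 k2 k3 k4 using hQ w k1 k2 k3 k4
  have hNt' : HasDerivAt (fun w => 2 * I * Nt w) (2 * I * (2 * (α : ℂ) * z - 2 * β)) z := by
    have h1 : HasDerivAt (fun w : ℂ => (α : ℂ) * w ^ 2 - 2 * (β : ℂ) * w + (γ : ℂ))
        ((α : ℂ) * (2 * z) - 2 * (β : ℂ) * 1) z := by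
      have hp : HasDerivAt (fun w : ℂ => w ^ 2) (2 * z) z := by simpa using hasDerivAt_pow 2 z
      exact ((hp.const_mul (α : ℂ)).sub ((hasDerivAt_id z).const_mul (2 * (β : ℂ)))).add_const (γ : ℂ)
    have h2 := h1.const_mul (2 * I)
    refine h2.congr_deriv ?_
    ring
  have hDen' : HasDerivAt Den (deriv Den z) z := by
    have : DifferentiableAt ℂ Den z := by simp only [hDendef]; fun_prop
    exact this.hasDerivAt
  have hquot := hNt'.div hDen' hDenz
  rw [hev.deriv_eq, show (fun w => 2 * I * Nt w / Den w) = (fun w => 2 * I * Nt w) / Den from rfl, hquot.deriv]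
  simp only [hNtz, mul_zero, zero_mul, sub_zero]
  exact div_ne_zero (mul_ne_zero (mul_ne_zero (mul_ne_zero two_ne_zero I_ne_zero) hNt'ne) hDenz) (pow_ne_zero 2 hDenz)

/-! ### 3. Behaviour of `P_c` at infinity -/

/-- `log|w-a| - log|w-a'| → 0` as `w → ∞`. [folklore] -/
theorem tendsto_log_norm_sub_sub_cocompact (a a' : ℂ) :
    Tendsto (fun w : ℂ => Real.log ‖w - a‖ - Real.log ‖w - a'‖) (cocompact ℂ) (𝓝 0) := by
  have hn : Tendsto (fun w : ℂ => ‖w - a'‖) (cocompact ℂ) atTop := by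
    have h1 : Tendsto (fun w : ℂ => ‖w‖ + -‖a'‖) (cocompact ℂ) atTop :=
      tendsto_atTop_add_const_right _ _ tendsto_norm_cocompact_atTop
    refine tendsto_atTop_mono (fun w => ?_) h1
    have := norm_sub_norm_le w a'
    have h2 : ‖w‖ - ‖a'‖ ≤ ‖w - a'‖ := by linarith [norm_sub_norm_le w a']
    linarith
  have hpos : ∀ᶠ w in cocompact ℂ, 0 < ‖w - a'‖ := hn.eventually (eventually_gt_atTop 0)
  have hpos' : ∀ᶠ w in cocompact ℂ, 0 < ‖w - a‖ := by
    have hn' : Tendsto (fun w : ℂ => ‖w - a‖) (cocompact ℂ) atTop := by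
      have h1 : Tendsto (fun w : ℂ => ‖w‖ + -‖a‖) (cocompact ℂ) atTop :=
        tendsto_atTop_add_const_right _ _ tendsto_norm_cocompact_atTop
      refine tendsto_atTop_mono (fun w => ?_) h1
      linarith [norm_sub_norm_le w a]
    exact hn'.eventually (eventually_gt_atTop 0)
  -- the ratio tends to `1`
  set f : ℂ → ℝ := fun w => ‖w - a‖ / ‖w - a'‖ with hf
  have hf1 : Tendsto f (cocompact ℂ) (𝓝 1) := by
    have hsub : Tendsto (fun w => f w - 1) (cocompact ℂ) (𝓝 0) := by
      have hbound : ∀ᶠ w in cocompact ℂ, ‖f w - 1‖ ≤ ‖a' - a‖ / ‖w - a'‖ := by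
        filter_upwards [hpos] with w hw
        have : f w - 1 = (‖w - a‖ - ‖w - a'‖) / ‖w - a'‖ := by
          rw [hf]
          field_simp
        rw [this, norm_div, Real.norm_of_nonneg hw.le]
        gcongr
        rw [Real.norm_eq_abs]
        have := abs_norm_sub_norm_le (w - a) (w - a')
        rwa [show w - a - (w - a') = a' - a by ring] at this
      refine squeeze_zero_norm' hbound ?_
      exact tendsto_const_nhds.div_atTop hn
    have := hsub.add_const 1
    simp only [sub_add_cancel, zero_add] at this
    exact this
  have hlog : Tendsto (fun w => Real.log (f w)) (cocompact ℂ) (𝓝 0) := by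
    have := (Real.continuousAt_log one_ne_zero).tendsto.comp hf1
    rwa [Real.log_one] at this
  refine hlog.congr' ?_
  filter_upwards [hpos, hpos'] with w hw hw'
  rw [hf]
  exact Real.log_div hw'.ne' hw.ne'

/-- **`P_c → 0` at `∞`** (both Green's functions vanish at `∞`). [folklore] -/
theorem tendsto_greenComboCHI_cocompact (a b : ℂ) (c : ℝ) :
    Tendsto (greenComboCHI a b c) (cocompact ℂ) (𝓝 0) := by
  have h := (tendsto_log_norm_sub_sub_cocompact a (conj a)).sub
    ((tendsto_log_norm_sub_sub_cocompact b (conj b)).const_mul c)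
  simp only [mul_zero, sub_zero] at h
  exact h

/-! ### 4. The uniqueness theorem in the half-plane -/

/-- The upper half-plane is preconnected (it is convex). [folklore] -/
theorem isPreconnected_upperHalfPlaneSet : IsPreconnected UpperHalfPlane.upperHalfPlaneSet := by
  refine Convex.isPreconnected fun x hx y hy s t hs ht hst => ?_
  simp only [UpperHalfPlane.upperHalfPlaneSet, mem_setOf_eq, Complex.add_im, Complex.real_smul, Complex.mul_im,
    Complex.ofReal_re, Complex.ofReal_im, zero_mul, add_zero] at hx hy ⊢
  rcases eq_or_lt_of_le hs with hs0 | hs0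
  · rw [← hs0, zero_add] at hst
    rw [← hs0, hst]
    simpa using hy
  · nlinarith [mul_pos hs0 hx, mul_nonneg ht hy.le]

/-- **Uniqueness of the spinor boundary value problem in `ℍ` (CHI15 Prop. 3.9 & Remark 2.9 (i),
`k = 1`, squared form).** Let `a ≠ b` in `ℍ`, let `q` be holomorphic on `ℍ ∖ {a, b}`, locally the
square of a holomorphic function (the square of a spinor), with `(w-b) q(w)` a square of a holomorphic
function on a punctured neighbourhood of `b` (the spinor branches at `b`), and let `h : ℂ → ℝ` satisfy
`dh = Re(q dw)` on `ℍ ∖ {a,b}` (a single-valued `Re ∫ q`) together with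
(1) `h → 0` at `∂ℍ ∪ {∞}` (`|h| < ε` off a compact subset of `ℍ`);
(2) for every boundary half-disc `{|w - x₀| < r} ∩ ℍ`, `x₀ ∈ ℝ`, there is a point where `h ≤ 0`
    (there is no boundary point near which `h > 0` — the conformally invariant, one-sided form of
    "`∂_ν h ≥ 0`" delivered by Chelkak–Smirnov's Remark 6.3; CHI's (2) "no point near which `h ≥ 0`"
    is stronger);
(3) `h` is bounded below near `b`;
(4) `(w - a) q(w) → 1` as `w → a` (normalisation `√(w-a) f → 1` at the source, squared).
Then `q = f_{[ℍ,a;b]}²` (`spinorSqCHI a b`) on `ℍ ∖ {a, b}`.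
[cite: ChelkakHonglerIzyurovAnnals2015, Prop. 3.9 ((1)–(4) ⇒ (2.6)–(2.8)) and Remark 2.9 (i) (uniqueness); §3.4, proof of Thm 2.16] -/
theorem eqOn_spinorSqCHI_of_bvp {a b : ℂ} (ha : 0 < a.im) (hb : 0 < b.im) (hab : a ≠ b)
    {q : ℂ → ℂ} {h : ℂ → ℝ}
    (hq : DifferentiableOn ℂ q (UpperHalfPlane.upperHalfPlaneSet \ {a, b}))
    (hsq : ∀ z ∈ UpperHalfPlane.upperHalfPlaneSet \ {a, b}, ∃ ε > 0, ∃ g : ℂ → ℂ,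
      DifferentiableOn ℂ g (ball z ε) ∧ ∀ w ∈ ball z ε, q w = g w ^ 2)
    (hsqb : ∃ ε > 0, ∃ k : ℂ → ℂ, DifferentiableOn ℂ k (ball b ε \ {b}) ∧
      ∀ w ∈ ball b ε \ {b}, (w - b) * q w = k w ^ 2)
    (hh : ∀ z ∈ UpperHalfPlane.upperHalfPlaneSet \ {a, b}, HasFDerivAt h (reMul (q z)) z)
    (h1 : ∀ ε > 0, ∃ K ⊆ UpperHalfPlane.upperHalfPlaneSet, IsCompact K ∧
      ∀ z ∈ UpperHalfPlane.upperHalfPlaneSet \ K, |h z| < ε)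
    (h2 : ∀ (x₀ : ℝ) (r : ℝ), 0 < r → ∃ z ∈ UpperHalfPlane.upperHalfPlaneSet, dist z x₀ < r ∧ h z ≤ 0)
    (h3 : ∃ r > 0, ∃ M : ℝ, ∀ z ∈ ball b r \ {b}, z ∈ UpperHalfPlane.upperHalfPlaneSet → M ≤ h z)
    (h4 : Tendsto (fun z => (z - a) * q z) (𝓝[≠] a) (𝓝 1)) :
    EqOn q (spinorSqCHI a b) (UpperHalfPlane.upperHalfPlaneSet \ {a, b}) := by
  set H : Set ℂ := UpperHalfPlane.upperHalfPlaneSet with hHdef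
  have hHo : IsOpen H := UpperHalfPlane.isOpen_upperHalfPlaneSet
  have hHc : IsPreconnected H := isPreconnected_upperHalfPlaneSet
  set D : Set ℂ := H \ {a, b} with hDdef
  have hDo : IsOpen D := hHo.sdiff (Set.toFinite {a, b}).isClosed
  have hmemD : ∀ {z : ℂ}, z ∈ D ↔ 0 < z.im ∧ z ≠ a ∧ z ≠ b := fun {z} => by
    simp only [hDdef, hHdef, Set.mem_sdiff, mem_setOf_eq, mem_insert_iff, mem_singleton_iff, not_or]
  have hconj : ∀ {z : ℂ}, 0 < z.im → z ≠ conj a ∧ z ≠ conj b := fun {z} hz =>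
    ⟨fun h => by have := congrArg Complex.im h; rw [Complex.conj_im] at this; linarith,
     fun h => by have := congrArg Complex.im h; rw [Complex.conj_im] at this; linarith⟩
  have hdist : 0 < dist b a := dist_pos.2 (Ne.symm hab)
  /- Part A: the source `a`: `q = 1/(w-a) + A`, `h = log|w-a| + Re 𝒜 + κa` near `a` -/
  set ra : ℝ := min a.im (dist b a) with hra
  have hra0 : 0 < ra := lt_min ha hdist
  have hballaH : ∀ w ∈ ball a ra, 0 < w.im ∧ w ≠ b := by
    intro w hw
    rw [mem_ball] at hw
    refine ⟨?_, fun h => ?_⟩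
    · have h1 : |(w - a).im| ≤ ‖w - a‖ := abs_im_le_norm _
      rw [Complex.sub_im, ← dist_eq_norm] at h1
      have := hw.trans_le (min_le_left _ _)
      rw [abs_le] at h1
      linarith [h1.1]
    · rw [h] at hw
      exact lt_irrefl _ (hw.trans_le (min_le_right _ _))
  have hballa : ball a ra \ {a} ⊆ D := fun w hw =>
    hmemD.2 ⟨(hballaH w hw.1).1, hw.2, (hballaH w hw.1).2⟩
  set W : ℂ → ℂ := fun w => (w - a) * q w with hW
  set Wa : ℂ → ℂ := Function.update W a 1 with hWa
  have hWad : DifferentiableOn ℂ Wa (ball a ra) := by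
    refine (Complex.differentiableOn_compl_singleton_and_continuousAt_iff (ball_mem_nhds a hra0)).1 ⟨?_, ?_⟩
    · have hWd : DifferentiableOn ℂ W (ball a ra \ {a}) := DifferentiableOn.mul (by fun_prop) (hq.mono hballa)
      exact hWd.congr fun w hw => by simp only [hWa, Function.update_of_ne hw.2]
    · rw [hWa, continuousAt_update_same]
      exact h4
  set A : ℂ → ℂ := dslope Wa a with hA
  have hAd : DifferentiableOn ℂ A (ball a ra) := (Complex.differentiableOn_dslope (ball_mem_nhds a hra0)).2 hWad
  have hqA : ∀ w ∈ ball a ra \ {a}, q w = 1 / (w - a) + A w := by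
    intro w hw
    have hwa : w - a ≠ 0 := sub_ne_zero.2 hw.2
    have hAw : A w = (W w - 1) / (w - a) := by
      rw [hA, dslope_of_ne _ hw.2, slope_def_field]
      simp only [hWa, Function.update_self, Function.update_of_ne hw.2]
    rw [hAw, hW]
    field_simp
    ring
  obtain ⟨𝒜, h𝒜⟩ := hAd.isExactOn_ball
  have hwa_deriv : ∀ w ∈ ball a ra \ {a}, HasFDerivAt (fun w => h w - Real.log ‖w - a‖ - (𝒜 w).re) (0 : ℂ →L[ℝ] ℝ) w := by
    intro w hw
    have e1 := hh w (hballa hw)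
    have e2 := hasFDerivAt_log_norm_sub hw.2
    have e3 : HasFDerivAt (fun w => (𝒜 w).re) (reMul (A w)) w := by
      have := reCLM.hasFDerivAt.comp w ((h𝒜 w hw.1).hasFDerivAt.restrictScalars ℝ)
      refine this.congr_fderiv (ContinuousLinearMap.ext fun v => ?_)
      simp [mul_comm]
    refine ((e1.sub e2).sub e3).congr_fderiv ?_
    rw [reMul_sub, reMul_sub]
    ext v
    simp only [reMul_apply, hqA w hw, _root_.zero_apply]
    simp
  obtain ⟨κa, hκa⟩ := (isOpen_ball.sdiff isClosed_singleton).exists_is_const_of_fderiv_eq_zero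
    (Literature.Topology.Euclidean.isPreconnected_ball_diff_singleton a ra)
    (fun w hw => (hwa_deriv w hw).differentiableAt.differentiableWithinAt) (fun w hw => (hwa_deriv w hw).fderiv)
  have hha : ∀ w ∈ ball a ra \ {a}, h w = Real.log ‖w - a‖ + (𝒜 w).re + κa := by
    intro w hw
    have := hκa w hw
    linarith
  /- Part B: Bôcher at `b`: `q = -c/(w-b) + gb`, `h = -c log|w-b| + Re Γb`, `c ≥ 0` -/
  obtain ⟨r₃, hr₃, M, hM⟩ := h3
  set rb : ℝ := min (min b.im (dist b a)) r₃ with hrb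
  have hrb0 : 0 < rb := lt_min (lt_min hb hdist) hr₃
  have hballbH : ∀ w ∈ ball b rb, 0 < w.im ∧ w ≠ a := by
    intro w hw
    rw [mem_ball] at hw
    refine ⟨?_, fun h => ?_⟩
    · have h1 : |(w - b).im| ≤ ‖w - b‖ := abs_im_le_norm _
      rw [Complex.sub_im, ← dist_eq_norm] at h1
      have := hw.trans_le ((min_le_left _ _).trans (min_le_left _ _))
      rw [abs_le] at h1
      linarith [h1.1]
    · rw [h, dist_comm] at hw
      exact lt_irrefl _ (hw.trans_le ((min_le_left _ _).trans (min_le_right _ _)))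
  have hballb : ball b rb \ {b} ⊆ D := fun w hw =>
    hmemD.2 ⟨(hballbH w hw.1).1, (hballbH w hw.1).2, hw.2⟩
  obtain ⟨cB, hcB, gb, Γb, hgbd, hΓb, hqgb, hhb⟩ :=
    exists_simplePole_of_re_primitive_bddBelow hrb0 (hq.mono hballb) (fun z hz => hh z (hballb hz))
      (fun z _ v => reMul_apply (q z) v)
      (fun z hz => hM z ⟨ball_subset_ball (min_le_right _ _) hz.1, hz.2⟩ (hballb hz).1)
  set c : ℝ := -cB with hc
  have hc0 : 0 ≤ c := by rw [hc]; linarith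
  /- Part C: `h = P_c` on `D` by the maximum principle on `ℍ` -/
  set P : ℂ → ℝ := greenComboCHI a b c with hP
  set Qc : ℂ → ℂ := greenComboSqCHI a b c with hQc
  have hfour : ∀ {w : ℂ}, w ∈ D → w ≠ a ∧ w ≠ conj a ∧ w ≠ b ∧ w ≠ conj b := fun {w} hw =>
    ⟨(hmemD.1 hw).2.1, (hconj (hmemD.1 hw).1).1, (hmemD.1 hw).2.2, (hconj (hmemD.1 hw).1).2⟩
  have hPderiv : ∀ w ∈ D, HasFDerivAt P (reMul (Qc w)) w := fun w hw =>
    hasFDerivAt_greenComboCHI c (hfour hw).1 (hfour hw).2.1 (hfour hw).2.2.1 (hfour hw).2.2.2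
  have hQcd : DifferentiableOn ℂ Qc D := fun w hw =>
    (differentiableAt_greenComboSqCHI c (hfour hw).1 (hfour hw).2.1 (hfour hw).2.2.1 (hfour hw).2.2.2).differentiableWithinAt
  have hu : ∀ w ∈ D, HasFDerivAt (fun w => h w - P w) (reMul (q w - Qc w)) w := fun w hw => by
    rw [← reMul_sub]; exact (hh w hw).sub (hPderiv w hw)
  -- the harmonic extension `ũ` of `h - P` across `a` and `b`
  set Φa : ℂ → ℝ := fun w => (𝒜 w + (κa : ℂ)).re + Real.log ‖w - conj a‖ +
    c * (Real.log ‖w - b‖ - Real.log ‖w - conj b‖) with hΦa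
  set Φb : ℂ → ℝ := fun w => (Γb w).re - Real.log ‖w - a‖ + Real.log ‖w - conj a‖ -
    c * Real.log ‖w - conj b‖ with hΦb
  set ũ : ℂ → ℝ := fun w => if w = a then Φa a else if w = b then Φb b else h w - P w with hũ
  have hũa : ũ =ᶠ[𝓝 a] Φa := by
    filter_upwards [ball_mem_nhds a hra0] with w hw
    by_cases hwa : w = a
    · simp [hũ, hwa]
    have hwb : w ≠ b := (hballaH w hw).2
    simp only [hũ, if_neg hwa, if_neg hwb]
    rw [hha w ⟨hw, hwa⟩, hP, hΦa]
    simp only [greenComboCHI, Complex.add_re, Complex.ofReal_re]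
    ring
  have hũb : ũ =ᶠ[𝓝 b] Φb := by
    filter_upwards [ball_mem_nhds b hrb0] with w hw
    by_cases hwb : w = b
    · subst hwb
      simp [hũ, Ne.symm hab]
    have hwa : w ≠ a := (hballbH w hw).2
    simp only [hũ, if_neg hwa, if_neg hwb]
    rw [hhb w ⟨hw, hwb⟩, hP, hΦb, hc]
    simp only [greenComboCHI]
    ring
  have hũD : ∀ w ∈ D, ũ =ᶠ[𝓝 w] fun w => h w - P w := by
    intro w hw
    filter_upwards [eventually_ne_nhds (hmemD.1 hw).2.1, eventually_ne_nhds (hmemD.1 hw).2.2] with x hxa hxb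
    simp only [hũ, if_neg hxa, if_neg hxb]
  have hũD' : ∀ w ∈ D, ũ w = h w - P w := fun w hw => (hũD w hw).self_of_nhds
  have hharm : HarmonicOnNhd ũ H := by
    intro w hw
    by_cases hwa : w = a
    · subst hwa
      rw [harmonicAt_congr_nhds hũa, hΦa]
      have hane : w - conj w ≠ 0 := (spinor_ne_zero_aux ha hb hab).1
      have e1 : HarmonicAt (fun x => (𝒜 x + (κa : ℂ)).re) w :=
        ((DifferentiableOn.analyticAt (fun x hx => (h𝒜 x hx).differentiableAt.differentiableWithinAt)
          (ball_mem_nhds w hra0)).add analyticAt_const).harmonicAt_re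
      have e2 : HarmonicAt (fun x => Real.log ‖x - conj w‖) w :=
        (analyticAt_id.sub analyticAt_const).harmonicAt_log_norm (sub_ne_zero.2 (hconj ha).1)
      have e3 : HarmonicAt (fun x => Real.log ‖x - b‖) w :=
        (analyticAt_id.sub analyticAt_const).harmonicAt_log_norm (sub_ne_zero.2 hab)
      have e4 : HarmonicAt (fun x => Real.log ‖x - conj b‖) w :=
        (analyticAt_id.sub analyticAt_const).harmonicAt_log_norm (sub_ne_zero.2 (hconj ha).2)
      have e5 := (e1.add e2).add ((e3.sub e4).const_smul (c := c))
      refine (harmonicAt_congr_nhds ?_).2 e5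
      exact Eventually.of_forall fun x => by simp [smul_eq_mul]
    by_cases hwb : w = b
    · subst hwb
      rw [harmonicAt_congr_nhds hũb, hΦb]
      have e1 : HarmonicAt (fun x => (Γb x).re) w :=
        (DifferentiableOn.analyticAt (fun x hx => (hΓb x hx).differentiableAt.differentiableWithinAt)
          (ball_mem_nhds w hrb0)).harmonicAt_re
      have e2 : HarmonicAt (fun x => Real.log ‖x - a‖) w :=
        (analyticAt_id.sub analyticAt_const).harmonicAt_log_norm (sub_ne_zero.2 (Ne.symm hab))
      have e3 : HarmonicAt (fun x => Real.log ‖x - conj a‖) w :=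
        (analyticAt_id.sub analyticAt_const).harmonicAt_log_norm (sub_ne_zero.2 (hconj hb).1)
      have e4 : HarmonicAt (fun x => Real.log ‖x - conj w‖) w :=
        (analyticAt_id.sub analyticAt_const).harmonicAt_log_norm (sub_ne_zero.2 (hconj hb).2)
      have e5 := ((e1.sub e2).add e3).sub (e4.const_smul (c := c))
      refine (harmonicAt_congr_nhds ?_).2 e5
      exact Eventually.of_forall fun x => by simp [smul_eq_mul]
    · have hwD : w ∈ D := hmemD.2 ⟨hw, hwa, hwb⟩
      rw [harmonicAt_congr_nhds (hũD w hwD)]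
      exact harmonicAt_of_hasFDerivAt_reMul hDo (hq.sub hQcd) hu hwD
  -- boundary behaviour on `∂ℍ = ℝ`
  have hbdry : ∀ ζ ∈ frontier H, ∀ ε : ℝ, 0 < ε →
      (∀ᶠ z in 𝓝[H] ζ, ũ z ≤ 0 + ε) ∧ (∀ᶠ z in 𝓝[H] ζ, 0 - ε ≤ ũ z) := by
    intro ζ hζ ε hε
    rw [hHdef, show (UpperHalfPlane.upperHalfPlaneSet : Set ℂ) = {z : ℂ | 0 < z.im} from rfl,
      Complex.frontier_setOf_lt_im] at hζ
    have hζim : ζ.im = 0 := hζ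
    have hζ4 : |ζ.im| < min a.im b.im := by rw [hζim, abs_zero]; exact lt_min ha hb
    obtain ⟨k1, k2, k3, k4⟩ := ne_four_of_abs_im_lt hζ4
    obtain ⟨K, hKH, hK, hKh⟩ := h1 (ε / 2) (by positivity)
    have hζK : ζ ∉ K := fun h => by
      have : 0 < ζ.im := hKH h
      linarith
    have e1 : ∀ᶠ z in 𝓝[H] ζ, z ∈ H ∧ z ∉ K :=
      eventually_mem_nhdsWithin.and (mem_nhdsWithin_of_mem_nhds (hK.isClosed.compl_mem_nhds hζK))
    have hPζ : P ζ = 0 := by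
      have := greenComboCHI_ofReal a b c ζ.re
      have hζeq : ((ζ.re : ℝ) : ℂ) = ζ := Complex.ext (by simp) (by simp [hζim])
      rwa [hζeq] at this
    have hPcont : ContinuousAt P ζ := (hasFDerivAt_greenComboCHI c k1 k2 k3 k4).continuousAt
    have e2 : ∀ᶠ z in 𝓝[H] ζ, |P z| < ε / 2 := by
      refine mem_nhdsWithin_of_mem_nhds ?_
      have := (Metric.tendsto_nhds.1 hPcont.tendsto) (ε / 2) (by positivity)
      filter_upwards [this] with z hz
      rwa [hPζ, Real.dist_eq, sub_zero] at hz
    have e3 : ∀ᶠ z in 𝓝[H] ζ, z ≠ a ∧ z ≠ b :=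
      mem_nhdsWithin_of_mem_nhds ((eventually_ne_nhds k1).and (eventually_ne_nhds k3))
    constructor
    · filter_upwards [e1, e2, e3] with z hz1 hz2 hz3
      have hzD : z ∈ D := hmemD.2 ⟨hz1.1, hz3.1, hz3.2⟩
      have := hKh z ⟨hz1.1, hz1.2⟩
      rw [hũD' z hzD]
      rw [abs_lt] at this hz2
      linarith
    · filter_upwards [e1, e2, e3] with z hz1 hz2 hz3
      have hzD : z ∈ D := hmemD.2 ⟨hz1.1, hz3.1, hz3.2⟩
      have := hKh z ⟨hz1.1, hz1.2⟩
      rw [hũD' z hzD]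
      rw [abs_lt] at this hz2
      linarith
  -- behaviour at `∞`
  have hinf : ∀ ε : ℝ, 0 < ε →
      (∀ᶠ z in cocompact ℂ ⊓ 𝓟 H, ũ z ≤ 0 + ε) ∧ (∀ᶠ z in cocompact ℂ ⊓ 𝓟 H, 0 - ε ≤ ũ z) := by
    intro ε hε
    obtain ⟨K, hKH, hK, hKh⟩ := h1 (ε / 2) (by positivity)
    have e1 : ∀ᶠ z in cocompact ℂ, z ∉ K := hK.compl_mem_cocompact
    have e2 : ∀ᶠ z in cocompact ℂ, |P z| < ε / 2 := by
      have := (Metric.tendsto_nhds.1 (tendsto_greenComboCHI_cocompact a b c)) (ε / 2) (by positivity)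
      filter_upwards [this] with z hz
      rwa [Real.dist_eq, sub_zero] at hz
    have e3 : ∀ᶠ z in cocompact ℂ, z ≠ a ∧ z ≠ b := by
      have : ∀ᶠ z in cocompact ℂ, z ∉ ({a, b} : Set ℂ) := (Set.toFinite {a, b}).isCompact.compl_mem_cocompact
      filter_upwards [this] with z hz
      simpa [not_or] using hz
    rw [Filter.eventually_inf_principal, Filter.eventually_inf_principal]
    constructor
    · filter_upwards [e1, e2, e3] with z hz1 hz2 hz3 hzH
      have hzD : z ∈ D := hmemD.2 ⟨hzH, hz3.1, hz3.2⟩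
      have := hKh z ⟨hzH, hz1⟩
      rw [hũD' z hzD]
      rw [abs_lt] at this hz2
      linarith
    · filter_upwards [e1, e2, e3] with z hz1 hz2 hz3 hzH
      have hzD : z ∈ D := hmemD.2 ⟨hzH, hz3.1, hz3.2⟩
      have := hKh z ⟨hzH, hz1⟩
      rw [hũD' z hzD]
      rw [abs_lt] at this hz2
      linarith
  have hle : ∀ z ∈ H, ũ z ≤ 0 := harmonic_le_of_frontier_of_cocompact hHo hHc hharm
    (fun ζ hζ ε hε => (hbdry ζ hζ ε hε).1) (fun ε hε => (hinf ε hε).1)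
  have hge : ∀ z ∈ H, 0 ≤ ũ z := harmonic_ge_of_frontier_of_cocompact hHo hHc hharm
    (fun ζ hζ ε hε => (hbdry ζ hζ ε hε).2) (fun ε hε => (hinf ε hε).2)
  have hhP : ∀ w ∈ D, h w = P w := by
    intro w hw
    have h0 : ũ w = 0 := le_antisymm (hle w hw.1) (hge w hw.1)
    rw [hũD' w hw] at h0
    linarith
  have hqQ : ∀ w ∈ D, q w = Qc w := by
    intro w hw
    have heq : h =ᶠ[𝓝 w] P := by
      filter_upwards [hDo.mem_nhds hw] with x hx using hhP x hx
    exact eq_of_hasFDerivAt_reMul (hh w hw) ((hPderiv w hw).congr_of_eventuallyEq heq)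
  /- Part D: the residue at `b` is `𝓑²` -/
  rcases lt_trichotomy c (bCHI a b ^ 2) with hlt | heq | hgt
  · exfalso
    rcases eq_or_lt_of_le hc0 with hc00 | hcpos
    · -- `c = 0`: `q` would be holomorphic and non-zero at `b`, contradicting the branching there
      obtain ⟨ε, hε, k, hkd, hk⟩ := hsqb
      set Q0 : ℂ → ℂ := fun w => 1 / (w - a) - 1 / (w - conj a) with hQ0
      have hQc0 : Qc = Q0 := by
        funext w
        simp [hQc, hQ0, greenComboSqCHI, ← hc00]
      obtain ⟨-, hba, -, hba'', -, -⟩ := spinor_ne_zero_aux ha hb hab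
      have hQ0d : DifferentiableAt ℂ Q0 b := by
        have e1 : DifferentiableAt ℂ (fun w : ℂ => 1 / (w - a)) b :=
          (differentiableAt_const _).div (differentiableAt_id.sub_const a) hba
        have e2 : DifferentiableAt ℂ (fun w : ℂ => 1 / (w - conj a)) b :=
          (differentiableAt_const _).div (differentiableAt_id.sub_const (conj a)) hba''
        exact e1.sub e2
      have hQ0b : Q0 b ≠ 0 := by
        rw [hQ0]
        simp only
        rw [div_sub_div _ _ hba hba'', one_mul, mul_one]
        refine div_ne_zero ?_ (mul_ne_zero hba hba'')
        rw [show b - conj a - (b - a) = a - conj a by ring]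
        exact (spinor_ne_zero_aux ha hb hab).1
      set T : ℂ → ℂ := fun w => (w - b) * Q0 w with hT
      have hTderiv : HasDerivAt T (Q0 b) b := by
        have := ((hasDerivAt_id' b).sub_const b).fun_mul hQ0d.hasDerivAt
        simpa [hT] using this
      -- `k² = T` on a punctured disc, `k → 0`
      set ε' : ℝ := min ε rb with hε'
      have hε'0 : 0 < ε' := lt_min hε hrb0
      have hkT : ∀ w ∈ ball b ε' \ {b}, k w ^ 2 = T w := by
        intro w hw
        have hwD : w ∈ D := hballb ⟨ball_subset_ball (min_le_right _ _) hw.1, hw.2⟩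
        rw [← hk w ⟨ball_subset_ball (min_le_left _ _) hw.1, hw.2⟩, hT]
        simp only
        rw [hqQ w hwD, hQc0]
      have hTcont : ContinuousAt T b := hTderiv.continuousAt
      have hTb : T b = 0 := by simp [hT]
      have hk0 : Tendsto k (𝓝[≠] b) (𝓝 0) := by
        rw [tendsto_zero_iff_norm_tendsto_zero]
        have hsq : Tendsto (fun w => ‖k w‖ ^ 2) (𝓝[≠] b) (𝓝 0) := by
          have hT0 : Tendsto (fun w => ‖T w‖) (𝓝[≠] b) (𝓝 0) := by
            have := hTcont.tendsto.norm
            rw [hTb, norm_zero] at this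
            exact this.mono_left nhdsWithin_le_nhds
          refine hT0.congr' ?_
          have : ∀ᶠ w in 𝓝[≠] b, w ∈ ball b ε' \ {b} := by
            filter_upwards [mem_nhdsWithin_of_mem_nhds (ball_mem_nhds b hε'0), self_mem_nhdsWithin] with w h1 h2
            exact ⟨h1, h2⟩
          filter_upwards [this] with w hw
          rw [← norm_pow, hkT w hw]
        have := (Real.continuous_sqrt.tendsto 0).comp hsq
        rw [Real.sqrt_zero] at this
        refine this.congr fun w => ?_
        simp [Real.sqrt_sq (norm_nonneg _)]
      set kt : ℂ → ℂ := Function.update k b 0 with hkt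
      have hktd : DifferentiableOn ℂ kt (ball b ε') := by
        refine (Complex.differentiableOn_compl_singleton_and_continuousAt_iff (ball_mem_nhds b hε'0)).1 ⟨?_, ?_⟩
        · exact (hkd.mono (sdiff_subset_sdiff_left (ball_subset_ball (min_le_left _ _)))).congr
            fun w hw => by simp only [hkt, Function.update_of_ne hw.2]
        · rw [hkt, continuousAt_update_same]
          exact hk0
      have hev : (fun w => kt w ^ 2) =ᶠ[𝓝 b] T := by
        filter_upwards [ball_mem_nhds b hε'0] with w hw
        by_cases hwb : w = b
        · subst hwb
          simp [hkt, hTb]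
        · rw [← hkT w ⟨hw, hwb⟩]
          simp only [hkt, Function.update_of_ne hwb]
      have hkt' : HasDerivAt (fun w => kt w ^ 2) (2 * kt b * deriv kt b) b := by
        have := ((hktd.differentiableAt (ball_mem_nhds b hε'0)).hasDerivAt).fun_pow 2
        simpa using this
      have hktb : kt b = 0 := by simp [hkt]
      rw [hktb, mul_zero, zero_mul] at hkt'
      have : Q0 b = 0 := hTderiv.unique (hkt'.congr_of_eventuallyEq hev.symm)
      exact hQ0b this
    · -- `0 < c < 𝓑²`: a simple zero of `q` in `ℍ`, contradicting the spinor structure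
      obtain ⟨z, hzim, hza, hzb, hQz, hQ'z⟩ := exists_simpleZero_greenComboSq ha hb hab hcpos hlt
      have hzD : z ∈ D := hmemD.2 ⟨hzim, hza, hzb⟩
      obtain ⟨ε, hε, g, hgd, hg⟩ := hsq z hzD
      have hev : Qc =ᶠ[𝓝 z] fun w => g w ^ 2 := by
        filter_upwards [hDo.mem_nhds hzD, ball_mem_nhds z hε] with w hwD hwb
        rw [← hqQ w hwD, hg w hwb]
      have hgz : g z = 0 := by
        have := hg z (mem_ball_self hε)
        rw [hqQ z hzD, show Qc z = greenComboSqCHI a b c z from rfl, hQz] at this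
        exact pow_eq_zero_iff two_ne_zero |>.1 this.symm
      have h2' : HasDerivAt (fun w => g w ^ 2) (2 * g z * deriv g z) z := by
        have := ((hgd.differentiableAt (ball_mem_nhds z hε)).hasDerivAt).fun_pow 2
        simpa using this
      have h3' : deriv (greenComboSqCHI a b c) z = 2 * g z * deriv g z := by
        rw [show greenComboSqCHI a b c = Qc from rfl, hev.deriv_eq, h2'.deriv]
      rw [hgz, mul_zero, zero_mul] at h3'
      exact hQ'z h3'
  · -- `c = 𝓑²`: the conclusion
    intro w hw
    rw [hqQ w hw, show Qc w = greenComboSqCHI a b c w from rfl, heq]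
    exact (spinorSqCHI_eq_greenComboSqCHI ha hb hab (hfour hw).1 (hfour hw).2.1 (hfour hw).2.2.1 (hfour hw).2.2.2).symm
  · -- `c > 𝓑²`: `h = P_c > 0` on a boundary half-disc, contradicting (2)
    exfalso
    obtain ⟨x₀, hx₀⟩ := exists_sigma_neg ha hb hab hgt
    have him : (greenComboSqCHI a b c x₀).im < 0 := by
      rw [greenComboSqCHI_ofReal ha hb]
      simp only [Complex.mul_im, Complex.ofReal_re, Complex.I_im, mul_one, Complex.ofReal_im, Complex.I_re,
        mul_zero, add_zero]
      linarith
    obtain ⟨r, hr, hrle, hpos⟩ := greenComboCHI_pos_of_im_neg ha hb him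
    obtain ⟨w, hwH, hwd, hwh⟩ := h2 x₀ r hr
    have hwim : 0 < w.im := hwH
    have hw4 : |w.im| < min a.im b.im := by
      have h1 : |(w - x₀).im| ≤ ‖w - (x₀ : ℂ)‖ := abs_im_le_norm _
      rw [Complex.sub_im, Complex.ofReal_im, sub_zero, ← dist_eq_norm] at h1
      exact lt_of_le_of_lt h1 (hwd.trans_le hrle)
    obtain ⟨k1, -, k3, -⟩ := ne_four_of_abs_im_lt hw4
    have hwD : w ∈ D := hmemD.2 ⟨hwim, k1, k3⟩
    have := hpos w hwd hwim
    rw [← show P w = greenComboCHI a b c w from rfl, ← hhP w hwD] at this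
    linarith

/-! ### 5. The renormalised case: a bounded source forces `h ≡ 0` (CHI15 §3.4, via Lemma 3.10) -/

/-- **Bôcher with a two-sided bound: no singularity.** If `q` is holomorphic on a punctured disc and
its real primitive `h` (`dh = Re(q dz)`) is bounded there, then `q` extends holomorphically across the
centre and `h = Re Γ` for a primitive `Γ` (the residue `c ≤ 0` of Bôcher's theorem vanishes, since
`c log|z-b| → +∞` would contradict the upper bound). [cite: AxlerBourdonRamey2001, Thm. 3.9 (Bôcher's theorem), planar case] -/
theorem exists_holomorphic_of_re_primitive_bounded {q : ℂ → ℂ} {h : ℂ → ℝ} {b : ℂ} {R M : ℝ} (hR : 0 < R)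
    (hq : DifferentiableOn ℂ q (ball b R \ {b}))
    (hh : ∀ z ∈ ball b R \ {b}, HasFDerivAt h (reMul (q z)) z)
    (hM : ∀ z ∈ ball b R \ {b}, |h z| ≤ M) :
    ∃ g Γ : ℂ → ℂ, DifferentiableOn ℂ g (ball b R) ∧ (∀ z ∈ ball b R, HasDerivAt Γ (g z) z) ∧
      (∀ z ∈ ball b R \ {b}, q z = g z) ∧ ∀ z ∈ ball b R \ {b}, h z = (Γ z).re := by
  obtain ⟨c, hc0, g, Γ, hgd, hΓ, hqg, hhΓ⟩ :=
    exists_simplePole_of_re_primitive_bddBelow hR hq hh (fun z _ v => reMul_apply _ v)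
      (fun z hz => (abs_le.1 (hM z hz)).1)
  -- the upper bound forces `c = 0`
  have hc : c = 0 := by
    by_contra hcne
    have hcneg : c < 0 := lt_of_le_of_ne hc0 hcne
    have hΓc : ContinuousAt Γ b := (hΓ b (mem_ball_self hR)).continuousAt
    obtain ⟨δ, hδ, hδΓ⟩ := Metric.continuousAt_iff.1 hΓc 1 one_pos
    set t₀ : ℝ := Real.exp ((M - (Γ b).re + 2) / c) with ht₀
    set t : ℝ := min (δ / 2) (min (R / 2) t₀) with ht
    have ht0 : 0 < t := by positivity
    have htδ : t < δ := by
      have : t ≤ δ / 2 := min_le_left _ _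
      linarith
    have htR : t < R := by
      have : t ≤ R / 2 := (min_le_right _ _).trans (min_le_left _ _)
      linarith
    have htt₀ : t ≤ t₀ := (min_le_right _ _).trans (min_le_right _ _)
    set z : ℂ := b + t with hz
    have hzb : z - b = t := by rw [hz]; ring
    have hzD : z ∈ ball b R \ {b} := ⟨by
        rw [mem_ball, dist_eq_norm, hzb, Complex.norm_real, Real.norm_eq_abs, abs_of_pos ht0]; exact htR,
      fun h0 => by
        have : (t : ℂ) = 0 := by rw [← hzb, mem_singleton_iff.1 h0, sub_self]
        exact ht0.ne' (by exact_mod_cast this)⟩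
    have hΓz : (Γ b).re - 1 ≤ (Γ z).re := by
      have hdist : dist z b < δ := by
        rw [dist_eq_norm, hzb, Complex.norm_real, Real.norm_eq_abs, abs_of_pos ht0]; exact htδ
      have h1 := hδΓ hdist
      rw [dist_eq_norm] at h1
      have h2 : |(Γ z - Γ b).re| ≤ ‖Γ z - Γ b‖ := abs_re_le_norm _
      rw [Complex.sub_re] at h2
      have h3 := neg_abs_le ((Γ z).re - (Γ b).re)
      linarith
    have hhz := hhΓ z hzD
    rw [hzb, Complex.norm_real, Real.norm_eq_abs, abs_of_pos ht0] at hhz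
    have hlogt : Real.log t ≤ (M - (Γ b).re + 2) / c := by
      calc Real.log t ≤ Real.log t₀ := Real.log_le_log ht0 htt₀
        _ = (M - (Γ b).re + 2) / c := by rw [ht₀, Real.log_exp]
    have h1 : M - (Γ b).re + 2 ≤ c * Real.log t := by
      have := mul_le_mul_of_nonpos_left hlogt hcneg.le
      rwa [mul_div_cancel₀ _ hcneg.ne] at this
    have h2 : h z ≤ M := (abs_le.1 (hM z hzD)).2
    linarith
  refine ⟨g, Γ, hgd, hΓ, fun z hz => ?_, fun z hz => ?_⟩
  · rw [hqg z hz, hc]; simp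
  · rw [hhΓ z hz, hc]; simp

/-- **The renormalised limit vanishes (CHI15 §3.4: "by the maximum principle, this yields
`h̃ ≡ 0`").** Let `q` be holomorphic on `ℍ ∖ {a,b}` with single-valued real primitive `h`
(`dh = Re(q dw)`) such that (1) `h → 0` at `∂ℍ ∪ {∞}`, (2) every boundary half-disc contains a point
with `h ≤ 0` (the one-sided form of "`∂_ν h ≥ 0`"), (3) `h` is bounded below near `b`, and (4') `h` is
**bounded** near `a` (the limits of `M_δ(ε)⁻¹ H_δ` in the proof of Thm 2.16, whose source singularity
has been scaled away: "`h̃^{(a)} = h̃` is also bounded in a neighborhood of `a`"). Then `h ≡ 0` and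
`q ≡ 0` on `ℍ ∖ {a,b}`: by Bôcher at `a` (no singularity) and at `b` (`h = -c log|w-b| + O(1)`, `c ≥ 0`),
`h - c G_ℍ(·;b)` is harmonic on `ℍ` and tends to `0` at the boundary, so `h = c G_ℍ(·;b) ≥ 0`, and (2)
forces `c = 0`. (No spinor structure is needed here.)
[cite: ChelkakHonglerIzyurovAnnals2015, §3.4, proof of Thm 2.16 (renormalised functions (M_δ(ε))⁻¹H_δ: "this yields h̃ ≡ 0, which is a contradiction" with Lemma 3.10)] -/
theorem eq_zero_of_bvp_bounded {a b : ℂ} (ha : 0 < a.im) (hb : 0 < b.im) (hab : a ≠ b)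
    {q : ℂ → ℂ} {h : ℂ → ℝ}
    (hq : DifferentiableOn ℂ q (UpperHalfPlane.upperHalfPlaneSet \ {a, b}))
    (hh : ∀ z ∈ UpperHalfPlane.upperHalfPlaneSet \ {a, b}, HasFDerivAt h (reMul (q z)) z)
    (h1 : ∀ ε > 0, ∃ K ⊆ UpperHalfPlane.upperHalfPlaneSet, IsCompact K ∧
      ∀ z ∈ UpperHalfPlane.upperHalfPlaneSet \ K, |h z| < ε)
    (h2 : ∀ (x₀ : ℝ) (r : ℝ), 0 < r → ∃ z ∈ UpperHalfPlane.upperHalfPlaneSet, dist z x₀ < r ∧ h z ≤ 0)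
    (h3 : ∃ r > 0, ∃ M : ℝ, ∀ z ∈ ball b r \ {b}, z ∈ UpperHalfPlane.upperHalfPlaneSet → M ≤ h z)
    (h4 : ∃ r > 0, ∃ M : ℝ, ∀ z ∈ ball a r \ {a}, z ∈ UpperHalfPlane.upperHalfPlaneSet → |h z| ≤ M) :
    EqOn h 0 (UpperHalfPlane.upperHalfPlaneSet \ {a, b}) ∧
      EqOn q 0 (UpperHalfPlane.upperHalfPlaneSet \ {a, b}) := by
  set H : Set ℂ := UpperHalfPlane.upperHalfPlaneSet with hHdef
  have hHo : IsOpen H := UpperHalfPlane.isOpen_upperHalfPlaneSet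
  have hHc : IsPreconnected H := isPreconnected_upperHalfPlaneSet
  set D : Set ℂ := H \ {a, b} with hDdef
  have hDo : IsOpen D := hHo.sdiff (Set.toFinite {a, b}).isClosed
  have hmemD : ∀ {z : ℂ}, z ∈ D ↔ 0 < z.im ∧ z ≠ a ∧ z ≠ b := fun {z} => by
    simp only [hDdef, hHdef, Set.mem_sdiff, mem_setOf_eq, mem_insert_iff, mem_singleton_iff, not_or]
  have hconj : ∀ {z : ℂ}, 0 < z.im → z ≠ conj a ∧ z ≠ conj b := fun {z} hz =>
    ⟨fun h => by have := congrArg Complex.im h; rw [Complex.conj_im] at this; linarith,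
     fun h => by have := congrArg Complex.im h; rw [Complex.conj_im] at this; linarith⟩
  have hdist : 0 < dist b a := dist_pos.2 (Ne.symm hab)
  /- at `a`: no singularity -/
  obtain ⟨r₄, hr₄, Ma, hMa⟩ := h4
  set ra : ℝ := min (min a.im (dist b a)) r₄ with hra
  have hra0 : 0 < ra := lt_min (lt_min ha hdist) hr₄
  have hballaH : ∀ w ∈ ball a ra, 0 < w.im ∧ w ≠ b := by
    intro w hw
    rw [mem_ball] at hw
    refine ⟨?_, fun h => ?_⟩
    · have h1 : |(w - a).im| ≤ ‖w - a‖ := abs_im_le_norm _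
      rw [Complex.sub_im, ← dist_eq_norm] at h1
      have := hw.trans_le ((min_le_left _ _).trans (min_le_left _ _))
      rw [abs_le] at h1
      linarith [h1.1]
    · rw [h] at hw
      exact lt_irrefl _ (hw.trans_le ((min_le_left _ _).trans (min_le_right _ _)))
  have hballa : ball a ra \ {a} ⊆ D := fun w hw =>
    hmemD.2 ⟨(hballaH w hw.1).1, hw.2, (hballaH w hw.1).2⟩
  obtain ⟨ga, Γa, hgad, hΓa, hqga, hha⟩ :=
    exists_holomorphic_of_re_primitive_bounded hra0 (hq.mono hballa) (fun z hz => hh z (hballa hz))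
      (fun z hz => hMa z ⟨ball_subset_ball (min_le_right _ _) hz.1, hz.2⟩ (hballa hz).1)
  /- at `b`: Bôcher -/
  obtain ⟨r₃, hr₃, M, hM⟩ := h3
  set rb : ℝ := min (min b.im (dist b a)) r₃ with hrb
  have hrb0 : 0 < rb := lt_min (lt_min hb hdist) hr₃
  have hballbH : ∀ w ∈ ball b rb, 0 < w.im ∧ w ≠ a := by
    intro w hw
    rw [mem_ball] at hw
    refine ⟨?_, fun h => ?_⟩
    · have h1 : |(w - b).im| ≤ ‖w - b‖ := abs_im_le_norm _
      rw [Complex.sub_im, ← dist_eq_norm] at h1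
      have := hw.trans_le ((min_le_left _ _).trans (min_le_left _ _))
      rw [abs_le] at h1
      linarith [h1.1]
    · rw [h, dist_comm] at hw
      exact lt_irrefl _ (hw.trans_le ((min_le_left _ _).trans (min_le_right _ _)))
  have hballb : ball b rb \ {b} ⊆ D := fun w hw =>
    hmemD.2 ⟨(hballbH w hw.1).1, (hballbH w hw.1).2, hw.2⟩
  obtain ⟨cB, hcB, gb, Γb, hgbd, hΓb, hqgb, hhb⟩ :=
    exists_simplePole_of_re_primitive_bddBelow hrb0 (hq.mono hballb) (fun z hz => hh z (hballb hz))
      (fun z _ v => reMul_apply (q z) v)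
      (fun z hz => hM z ⟨ball_subset_ball (min_le_right _ _) hz.1, hz.2⟩ (hballb hz).1)
  set c : ℝ := -cB with hc
  have hc0 : 0 ≤ c := by rw [hc]; linarith
  /- `h = c G_b` by the maximum principle -/
  set P : ℂ → ℝ := fun w => c * (Real.log ‖w - conj b‖ - Real.log ‖w - b‖) with hP
  set Qc : ℂ → ℂ := fun w => (c : ℂ) * ((w - conj b)⁻¹ - (w - b)⁻¹) with hQc
  have hPderiv : ∀ w ∈ D, HasFDerivAt P (reMul (Qc w)) w := by
    intro w hw
    have k3 : w ≠ b := (hmemD.1 hw).2.2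
    have k4 : w ≠ conj b := (hconj (hmemD.1 hw).1).2
    have e := ((hasFDerivAt_log_norm_sub k4).sub (hasFDerivAt_log_norm_sub k3)).const_smul c
    have e' : HasFDerivAt P _ w := e
    refine e'.congr_fderiv ?_
    rw [reMul_sub, smul_reMul]
  have hQcd : DifferentiableOn ℂ Qc D := by
    intro w hw
    have k3 : w - b ≠ 0 := sub_ne_zero.2 (hmemD.1 hw).2.2
    have k4 : w - conj b ≠ 0 := sub_ne_zero.2 (hconj (hmemD.1 hw).1).2
    have e3 : DifferentiableAt ℂ (fun w : ℂ => (w - b)⁻¹) w := (differentiableAt_id.sub_const b).inv k3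
    have e4 : DifferentiableAt ℂ (fun w : ℂ => (w - conj b)⁻¹) w :=
      (differentiableAt_id.sub_const (conj b)).inv k4
    exact ((differentiableAt_const _).mul (e4.sub e3)).differentiableWithinAt
  have hu : ∀ w ∈ D, HasFDerivAt (fun w => h w - P w) (reMul (q w - Qc w)) w := fun w hw => by
    rw [← reMul_sub]; exact (hh w hw).sub (hPderiv w hw)
  set Φa : ℂ → ℝ := fun w => (Γa w).re - c * (Real.log ‖w - conj b‖ - Real.log ‖w - b‖) with hΦa
  set Φb : ℂ → ℝ := fun w => (Γb w).re - c * Real.log ‖w - conj b‖ with hΦb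
  set ũ : ℂ → ℝ := fun w => if w = a then Φa a else if w = b then Φb b else h w - P w with hũ
  have hũa : ũ =ᶠ[𝓝 a] Φa := by
    filter_upwards [ball_mem_nhds a hra0] with w hw
    by_cases hwa : w = a
    · simp [hũ, hwa]
    have hwb : w ≠ b := (hballaH w hw).2
    simp only [hũ, if_neg hwa, if_neg hwb]
    rw [hha w ⟨hw, hwa⟩]
  have hũb : ũ =ᶠ[𝓝 b] Φb := by
    filter_upwards [ball_mem_nhds b hrb0] with w hw
    by_cases hwb : w = b
    · subst hwb
      simp [hũ, Ne.symm hab]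
    have hwa : w ≠ a := (hballbH w hw).2
    simp only [hũ, if_neg hwa, if_neg hwb]
    rw [hhb w ⟨hw, hwb⟩, hP, hΦb, hc]
    ring
  have hũD : ∀ w ∈ D, ũ w = h w - P w := by
    intro w hw
    simp only [hũ, if_neg (hmemD.1 hw).2.1, if_neg (hmemD.1 hw).2.2]
  have hũDev : ∀ w ∈ D, ũ =ᶠ[𝓝 w] fun w => h w - P w := by
    intro w hw
    filter_upwards [hDo.mem_nhds hw] with x hx using hũD x hx
  have hharm : HarmonicOnNhd ũ H := by
    intro w hw
    by_cases hwa : w = a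
    · subst hwa
      rw [harmonicAt_congr_nhds hũa, hΦa]
      have e1 : HarmonicAt (fun x => (Γa x).re) w :=
        (DifferentiableOn.analyticAt (fun x hx => (hΓa x hx).differentiableAt.differentiableWithinAt)
          (ball_mem_nhds w hra0)).harmonicAt_re
      have e3 : HarmonicAt (fun x => Real.log ‖x - conj b‖) w :=
        (analyticAt_id.sub analyticAt_const).harmonicAt_log_norm (sub_ne_zero.2 (hconj hw).2)
      have e4 : HarmonicAt (fun x => Real.log ‖x - b‖) w :=
        (analyticAt_id.sub analyticAt_const).harmonicAt_log_norm (sub_ne_zero.2 hab)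
      have e5 := e1.sub ((e3.sub e4).const_smul (c := c))
      refine (harmonicAt_congr_nhds ?_).2 e5
      exact Eventually.of_forall fun x => by simp [smul_eq_mul]
    by_cases hwb : w = b
    · subst hwb
      rw [harmonicAt_congr_nhds hũb, hΦb]
      have e1 : HarmonicAt (fun x => (Γb x).re) w :=
        (DifferentiableOn.analyticAt (fun x hx => (hΓb x hx).differentiableAt.differentiableWithinAt)
          (ball_mem_nhds w hrb0)).harmonicAt_re
      have e4 : HarmonicAt (fun x => Real.log ‖x - conj w‖) w :=
        (analyticAt_id.sub analyticAt_const).harmonicAt_log_norm (sub_ne_zero.2 (hconj hw).2)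
      have e5 := e1.sub (e4.const_smul (c := c))
      refine (harmonicAt_congr_nhds ?_).2 e5
      exact Eventually.of_forall fun x => by simp [smul_eq_mul]
    · have hwD : w ∈ D := hmemD.2 ⟨hw, hwa, hwb⟩
      rw [harmonicAt_congr_nhds (hũDev w hwD)]
      exact harmonicAt_of_hasFDerivAt_reMul hDo (hq.sub hQcd) hu hwD
  -- `P = 0` on `ℝ`, `P → 0` at `∞`, `P` continuous off `{b, b̄}`
  have hPreal : ∀ ζ : ℂ, ζ.im = 0 → P ζ = 0 := by
    intro ζ hζ
    have : ‖ζ - conj b‖ = ‖ζ - b‖ := by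
      have hζeq : conj ζ = ζ := Complex.conj_eq_iff_im.2 hζ
      rw [show ζ - conj b = conj (ζ - b) by rw [map_sub, hζeq], Complex.norm_conj]
    simp [hP, this]
  have hPinf : Tendsto P (cocompact ℂ) (𝓝 0) := by
    have := (tendsto_log_norm_sub_sub_cocompact (conj b) b).const_mul c
    rw [mul_zero] at this
    exact this
  have hbdry : ∀ ζ ∈ frontier H, ∀ ε : ℝ, 0 < ε →
      (∀ᶠ z in 𝓝[H] ζ, ũ z ≤ 0 + ε) ∧ (∀ᶠ z in 𝓝[H] ζ, 0 - ε ≤ ũ z) := by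
    intro ζ hζ ε hε
    rw [hHdef, show (UpperHalfPlane.upperHalfPlaneSet : Set ℂ) = {z : ℂ | 0 < z.im} from rfl,
      Complex.frontier_setOf_lt_im] at hζ
    have hζim : ζ.im = 0 := hζ
    have hζ4 : |ζ.im| < min a.im b.im := by rw [hζim, abs_zero]; exact lt_min ha hb
    obtain ⟨k1, -, k3, k4⟩ := ne_four_of_abs_im_lt hζ4
    obtain ⟨K, hKH, hK, hKh⟩ := h1 (ε / 2) (by positivity)
    have hζK : ζ ∉ K := fun h => by
      have : 0 < ζ.im := hKH h
      linarith
    have e1 : ∀ᶠ z in 𝓝[H] ζ, z ∈ H ∧ z ∉ K :=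
      eventually_mem_nhdsWithin.and (mem_nhdsWithin_of_mem_nhds (hK.isClosed.compl_mem_nhds hζK))
    have hPcont : ContinuousAt P ζ :=
      (((hasFDerivAt_log_norm_sub k4).sub (hasFDerivAt_log_norm_sub k3)).const_smul c).continuousAt
    have e2 : ∀ᶠ z in 𝓝[H] ζ, |P z| < ε / 2 := by
      refine mem_nhdsWithin_of_mem_nhds ?_
      have := (Metric.tendsto_nhds.1 hPcont.tendsto) (ε / 2) (by positivity)
      filter_upwards [this] with z hz
      rwa [hPreal ζ hζim, Real.dist_eq, sub_zero] at hz
    have e3 : ∀ᶠ z in 𝓝[H] ζ, z ≠ a ∧ z ≠ b :=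
      mem_nhdsWithin_of_mem_nhds ((eventually_ne_nhds k1).and (eventually_ne_nhds k3))
    constructor
    · filter_upwards [e1, e2, e3] with z hz1 hz2 hz3
      have hzD : z ∈ D := hmemD.2 ⟨hz1.1, hz3.1, hz3.2⟩
      have := hKh z ⟨hz1.1, hz1.2⟩
      rw [hũD z hzD]
      rw [abs_lt] at this hz2
      linarith
    · filter_upwards [e1, e2, e3] with z hz1 hz2 hz3
      have hzD : z ∈ D := hmemD.2 ⟨hz1.1, hz3.1, hz3.2⟩
      have := hKh z ⟨hz1.1, hz1.2⟩
      rw [hũD z hzD]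
      rw [abs_lt] at this hz2
      linarith
  have hinf : ∀ ε : ℝ, 0 < ε →
      (∀ᶠ z in cocompact ℂ ⊓ 𝓟 H, ũ z ≤ 0 + ε) ∧ (∀ᶠ z in cocompact ℂ ⊓ 𝓟 H, 0 - ε ≤ ũ z) := by
    intro ε hε
    obtain ⟨K, hKH, hK, hKh⟩ := h1 (ε / 2) (by positivity)
    have e1 : ∀ᶠ z in cocompact ℂ, z ∉ K := hK.compl_mem_cocompact
    have e2 : ∀ᶠ z in cocompact ℂ, |P z| < ε / 2 := by
      have := (Metric.tendsto_nhds.1 hPinf) (ε / 2) (by positivity)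
      filter_upwards [this] with z hz
      rwa [Real.dist_eq, sub_zero] at hz
    have e3 : ∀ᶠ z in cocompact ℂ, z ≠ a ∧ z ≠ b := by
      have : ∀ᶠ z in cocompact ℂ, z ∉ ({a, b} : Set ℂ) :=
        (Set.toFinite {a, b}).isCompact.compl_mem_cocompact
      filter_upwards [this] with z hz
      simpa [not_or] using hz
    rw [Filter.eventually_inf_principal, Filter.eventually_inf_principal]
    constructor
    · filter_upwards [e1, e2, e3] with z hz1 hz2 hz3 hzH
      have hzD : z ∈ D := hmemD.2 ⟨hzH, hz3.1, hz3.2⟩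
      have := hKh z ⟨hzH, hz1⟩
      rw [hũD z hzD]
      rw [abs_lt] at this hz2
      linarith
    · filter_upwards [e1, e2, e3] with z hz1 hz2 hz3 hzH
      have hzD : z ∈ D := hmemD.2 ⟨hzH, hz3.1, hz3.2⟩
      have := hKh z ⟨hzH, hz1⟩
      rw [hũD z hzD]
      rw [abs_lt] at this hz2
      linarith
  have hle : ∀ z ∈ H, ũ z ≤ 0 := harmonic_le_of_frontier_of_cocompact hHo hHc hharm
    (fun ζ hζ ε hε => (hbdry ζ hζ ε hε).1) (fun ε hε => (hinf ε hε).1)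
  have hge : ∀ z ∈ H, 0 ≤ ũ z := harmonic_ge_of_frontier_of_cocompact hHo hHc hharm
    (fun ζ hζ ε hε => (hbdry ζ hζ ε hε).2) (fun ε hε => (hinf ε hε).2)
  have hhP : ∀ w ∈ D, h w = P w := by
    intro w hw
    have h0 : ũ w = 0 := le_antisymm (hle w hw.1) (hge w hw.1)
    rw [hũD w hw] at h0
    linarith
  /- (2) forces `c = 0`, since `G_ℍ(·;b) > 0` on `ℍ` -/
  have hc00 : c = 0 := by
    obtain ⟨w, hwH, hwd, hwh⟩ := h2 0 (min a.im b.im) (lt_min ha hb)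
    have hwim : 0 < w.im := hwH
    have hw4 : |w.im| < min a.im b.im := by
      have h1 : |(w - 0).im| ≤ ‖w - (0 : ℂ)‖ := abs_im_le_norm _
      rw [Complex.sub_im, Complex.zero_im, sub_zero, ← dist_eq_norm] at h1
      have hwd' : dist w 0 < min a.im b.im := by simpa using hwd
      exact lt_of_le_of_lt h1 hwd'
    obtain ⟨k1, -, k3, -⟩ := ne_four_of_abs_im_lt hw4
    have hwD : w ∈ D := hmemD.2 ⟨hwim, k1, k3⟩
    have hG : 0 < Real.log ‖w - conj b‖ - Real.log ‖w - b‖ := by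
      have hlt : ‖w - b‖ < ‖w - conj b‖ := norm_sub_lt_norm_sub_conj hb hwim
      have hpos : 0 < ‖w - b‖ := norm_pos_iff.2 (sub_ne_zero.2 k3)
      have := Real.log_lt_log hpos hlt
      linarith
    have hPw : h w = c * (Real.log ‖w - conj b‖ - Real.log ‖w - b‖) := hhP w hwD
    rw [hPw] at hwh
    by_contra hcne
    have hcpos : 0 < c := lt_of_le_of_ne hc0 (Ne.symm hcne)
    have := mul_pos hcpos hG
    linarith
  have hh0 : ∀ w ∈ D, h w = 0 := by
    intro w hw
    rw [hhP w hw, hP, hc00]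
    simp
  refine ⟨fun w hw => hh0 w hw, fun w hw => ?_⟩
  -- `q = 0`: the differential of the (locally) zero function
  have hz : HasFDerivAt h (reMul 0) w := by
    have hconst : HasFDerivAt (fun _ : ℂ => (0 : ℝ)) (0 : ℂ →L[ℝ] ℝ) w := hasFDerivAt_const 0 w
    have heq : (fun _ : ℂ => (0 : ℝ)) =ᶠ[𝓝 w] h := by
      filter_upwards [hDo.mem_nhds hw] with x hx using (hh0 x hx).symm
    have : (reMul 0 : ℂ →L[ℝ] ℝ) = 0 := by ext v; simp [reMul_apply]
    rw [this]
    exact hconst.congr_of_eventuallyEq heq.symm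
  exact eq_of_hasFDerivAt_reMul (hh w hw) hz

end Literature.Probability.LatticeModels

end
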